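import Literature.MathematicalPhysics.QuantumManyBody.PeriodicBoseGasScatteringODE
import Mathlib.MeasureTheory.Integral.IntervalIntegral.FundThmCalculus
import Mathlib.MeasureTheory.Integral.Prod
import Mathlib.Analysis.SpecialFunctions.ExpDeriv
import Mathlib.Analysis.Calculus.Deriv.MeanValue
import HarnessLib

/-!
# The zero-energy radial scattering equation for bounded potentials (proofs)

Topic `Literature/MathematicalPhysics/QuantumManyBody`, sibling of `PeriodicBoseGasScatteringODE.lean`
(provefact `Literature.MathematicalPhysics.QuantumManyBody.BoseGas.Fournais2020_condensation`, layer `LSSY2005_scatteringSolution`). For a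
*bounded* measurable potential profile `w ≤ M` (of finite range `R` where needed) this file develops
the theory of the regular zero-energy radial solution `u` of `u'' = ½ W u` (`W = w.toReal`),
defined in the sibling file by the monotone Volterra iteration [LSSY2005, (2.4)–(2.5)]:

* `radialIter_le_exp`, `radialSolE_ne_top`: `u_k(r) ≤ r e^{Mr²/4}` (a supersolution), so `u < ∞`;
* `radialSolE_eq` (monotone convergence) and the real forms `radialSol_eq`
  (`u = r + ∫_0^r (r-s)(W/2)u`), `radialSolDeriv_eq` (`u' = 1 + ∫_0^r (W/2)u`);
  `u'` continuous and non-decreasing, `u = ∫_0^r u'` (`radialSol_eq_integral_deriv`, Fubini on the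
  triangle), `hasDerivAt_radialSol`, `u(r) ≤ r u'(r)`;
* the **flux identity** `r u'(r) - u(r) = ∫_0^r s (W/2) u` (`mul_deriv_sub_sol_eq`; this is
  `u'(R) r² f'(r)` for the profile `f = u/(u'(R) r)`) and **integration by parts against the flux**
  `∫ (r u' - u) k' = [(r u' - u)k] - ∫ s(W/2)u k` for `k ∈ C¹` (`flux_integral_mul_deriv`) — the
  integrated form of the radial equation, obtained by Fubini without second derivatives;
* beyond the range (`w = 0` on `(ρ, ∞)`): `u'` constant, `u` affine (`radialSol_eq_of_ge`), hence
  `f = 1 - a/r` with `a = R - u(R)/u'(R)` (`radialProfile_eq_one_sub_div`,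
  `scatteringProfile_eq_one_sub_div`), `0 ≤ a < R`, `0 < f ≤ 1`, `f` Lipschitz
  (`lipschitzWith_radialProfile`, so `φ₀ = f(|x|)` is Lipschitz on `ℝ³`);
* **monotonicity in the potential** [LSSY2005, App. C, Lemma C.2]: for `w₁ ≤ w₂` the Wronskian
  `u₁'u₂ - u₁u₂' = ∫ ½(W₁ - W₂)u₁u₂ ≤ 0` (`wronskian_eq`, by the integral product rule
  `primitive_mul_primitive`), so `u₂/u₁ ↑ u₂'(R)/u₁'(R)` and the normalised profiles satisfy
  `f₂ ≤ f₁` (`radialProfile_antitone_pot`), `a₁ ≤ a₂` (`odeScatteringLength_mono_pot`).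

All statements are classical real analysis (Tonelli/Fubini on `(0,r]²`, FTC-1 for the continuous
`u'`, the mean value inequality); the potential enters only through `0 ≤ W ≤ M` and measurability.

## References

* [LSSY2005] E. H. Lieb, R. Seiringer, J. P. Solovej, J. Yngvason, *The Mathematics of the Bose
  Gas and its Condensation*, Birkhäuser 2005, arXiv:cond-mat/0610117: (2.4)–(2.5); App. C,
  Thm. C.1 (C.1)–(C.8), Lemma C.2.
* [Fournais2020] S. Fournais, *Length scales for BEC in the dilute Bose gas*, arXiv:2011.00309:
  App. A (A.1)–(A.2).
-/

noncomputable section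

open MeasureTheory Set Filter Topology
open scoped ENNReal NNReal

namespace Literature.MathematicalPhysics.QuantumManyBody.BoseGas

/-! ### Fubini on the triangle `{a < t < r ≤ b}` -/

section Triangle

/-- **Fubini on a triangle**: for `g, h ∈ L¹(a,b]`,
`∫_a^b (∫_a^r g) h(r) dr = ∫_a^b g(t) (∫_t^b h) dt`. This is the integration-by-parts formula for
the absolutely continuous primitive of `g`, in a form needing no differentiability. [folklore] -/
theorem setIntegral_Ioc_primitive_mul {a b : ℝ} {g h : ℝ → ℝ}
    (hg : IntegrableOn g (Ioc a b)) (hh : IntegrableOn h (Ioc a b)) :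
    ∫ r in Ioc a b, (∫ t in Ioc a r, g t) * h r = ∫ t in Ioc a b, g t * ∫ r in Ioc t b, h r := by
  set μ : Measure ℝ := volume.restrict (Ioc a b) with hμ
  set F : ℝ → ℝ → ℝ := fun r t => if t < r then g t * h r else 0 with hF
  have hFi : Integrable (Function.uncurry F) (μ.prod μ) := by
    have hp : Integrable (fun z : ℝ × ℝ => h z.1 * g z.2) (μ.prod μ) := hh.mul_prod hg
    have heq : Function.uncurry F = {z : ℝ × ℝ | z.2 < z.1}.indicator fun z => h z.1 * g z.2 := by
      funext z
      simp only [Function.uncurry, hF, indicator, mem_setOf_eq]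
      split_ifs <;> ring
    rw [heq]
    exact hp.indicator (measurableSet_lt measurable_snd measurable_fst)
  have hswap := integral_integral_swap hFi
  -- the left-hand sides agree
  have hL : ∫ r in Ioc a b, (∫ t in Ioc a r, g t) * h r = ∫ r, ∫ t, F r t ∂μ ∂μ := by
    refine setIntegral_congr_fun measurableSet_Ioc fun r hr => ?_
    have h1 : (fun t => F r t) = (Iio r).indicator fun t => g t * h r := by
      funext t; simp only [hF, indicator, mem_Iio]
    rw [h1, setIntegral_indicator measurableSet_Iio, integral_mul_const]
    congr 1
    have hset : Ioc a b ∩ Iio r = Ioo a r := by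
      ext t; simp only [mem_inter_iff, mem_Ioc, mem_Iio, mem_Ioo]
      constructor
      · rintro ⟨⟨h1, _⟩, h2⟩; exact ⟨h1, h2⟩
      · rintro ⟨h1, h2⟩; exact ⟨⟨h1, h2.le.trans hr.2⟩, h2⟩
    rw [hset, integral_Ioc_eq_integral_Ioo]
  -- the right-hand sides agree
  have hR : ∫ t in Ioc a b, g t * ∫ r in Ioc t b, h r = ∫ t, ∫ r, F r t ∂μ ∂μ := by
    refine setIntegral_congr_fun measurableSet_Ioc fun t ht => ?_
    have h1 : (fun r => F r t) = (Ioi t).indicator fun r => g t * h r := by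
      funext r; simp only [hF, indicator, mem_Ioi]
    rw [h1, setIntegral_indicator measurableSet_Ioi, integral_const_mul]
    congr 1
    have hset : Ioc a b ∩ Ioi t = Ioc t b := by
      ext r; simp only [mem_inter_iff, mem_Ioc, mem_Ioi]
      constructor
      · rintro ⟨⟨_, h2⟩, h3⟩; exact ⟨h3, h2⟩
      · rintro ⟨h1, h2⟩; exact ⟨⟨ht.1.trans h1, h2⟩, h1⟩
    rw [hset]
  rw [hL, hR, hswap]

/-- Fubini on the triangle with `h = 1`: `∫_a^b ∫_a^r g = ∫_a^b (b - t) g(t) dt` (`a ≤ b`). [folklore] -/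
theorem setIntegral_Ioc_primitive {a b : ℝ} {g : ℝ → ℝ} (hg : IntegrableOn g (Ioc a b)) :
    ∫ r in Ioc a b, (∫ t in Ioc a r, g t) = ∫ t in Ioc a b, (b - t) * g t := by
  have h1 : IntegrableOn (fun _ : ℝ => (1 : ℝ)) (Ioc a b) :=
    integrableOn_const (by rw [Real.volume_Ioc]; exact ENNReal.ofReal_ne_top)
  have h := setIntegral_Ioc_primitive_mul hg h1
  simp only [mul_one] at h
  rw [h]
  refine setIntegral_congr_fun measurableSet_Ioc fun t ht => ?_
  rw [setIntegral_const, Real.volume_real_Ioc_of_le ht.2, smul_eq_mul, mul_one, mul_comm]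

/-- **The integral product rule** (integration by parts for two primitives, via Fubini): if
`A(r) = A₀ + ∫_0^r α` and `B(r) = B₀ + ∫_0^r β` on `[0, T]` with `α, β ∈ L¹(0,T]`, then
`A(T)B(T) - A₀B₀ = ∫_0^T (αB + Aβ)`. [folklore] -/
theorem primitive_mul_primitive {T A₀ B₀ : ℝ} (hT : 0 ≤ T) {α β A B : ℝ → ℝ}
    (hα : IntegrableOn α (Ioc 0 T)) (hβ : IntegrableOn β (Ioc 0 T))
    (hA : ∀ r ∈ Icc 0 T, A r = A₀ + ∫ t in Ioc 0 r, α t)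
    (hB : ∀ r ∈ Icc 0 T, B r = B₀ + ∫ t in Ioc 0 r, β t)
    (hαB : IntegrableOn (fun r => α r * B r) (Ioc 0 T)) (hAβ : IntegrableOn (fun r => A r * β r) (Ioc 0 T)) :
    A T * B T - A₀ * B₀ = ∫ r in Ioc 0 T, (α r * B r + A r * β r) := by
  have hTm : T ∈ Icc 0 T := ⟨hT, le_rfl⟩
  -- `∫ αB = B₀ ∫α + ∫ α(s) ∫_0^s β`
  have h1 : ∫ r in Ioc 0 T, α r * B r =
      B₀ * (∫ r in Ioc 0 T, α r) + ∫ t in Ioc 0 T, β t * ∫ r in Ioc t T, α r := by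
    have heq : ∀ r ∈ Ioc 0 T, α r * B r = B₀ * α r + (∫ t in Ioc 0 r, β t) * α r := fun r hr => by
      rw [hB r ⟨hr.1.le, hr.2⟩]; ring
    rw [setIntegral_congr_fun measurableSet_Ioc heq, integral_add, integral_const_mul,
      setIntegral_Ioc_primitive_mul hβ hα]
    · exact hα.const_mul _
    · have : (fun r => (∫ t in Ioc 0 r, β t) * α r) =ᵐ[volume.restrict (Ioc 0 T)]
          fun r => α r * B r - B₀ * α r := by
        filter_upwards [ae_restrict_mem measurableSet_Ioc] with r hr
        rw [hB r ⟨hr.1.le, hr.2⟩]; ring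
      exact (hαB.sub (hα.const_mul _)).congr this.symm
  -- `∫ Aβ = A₀ ∫β + ∫ (∫_0^t α) β(t)`
  have h2 : ∫ t in Ioc 0 T, A t * β t =
      A₀ * (∫ t in Ioc 0 T, β t) + ∫ t in Ioc 0 T, (∫ r in Ioc 0 t, α r) * β t := by
    have heq : ∀ t ∈ Ioc 0 T, A t * β t = A₀ * β t + (∫ r in Ioc 0 t, α r) * β t := fun t ht => by
      rw [hA t ⟨ht.1.le, ht.2⟩]; ring
    rw [setIntegral_congr_fun measurableSet_Ioc heq, integral_add, integral_const_mul]
    · exact hβ.const_mul _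
    · have : (fun t => (∫ r in Ioc 0 t, α r) * β t) =ᵐ[volume.restrict (Ioc 0 T)]
          fun t => A t * β t - A₀ * β t := by
        filter_upwards [ae_restrict_mem measurableSet_Ioc] with t ht
        rw [hA t ⟨ht.1.le, ht.2⟩]; ring
      exact (hAβ.sub (hβ.const_mul _)).congr this.symm
  -- `∫ β(t) (∫_t^T α + ∫_0^t α) = (A T - A₀) ∫ β`
  have h3 : (∫ t in Ioc 0 T, β t * ∫ r in Ioc t T, α r) + ∫ t in Ioc 0 T, (∫ r in Ioc 0 t, α r) * β t =
      (A T - A₀) * ∫ t in Ioc 0 T, β t := by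
    have hi1 : IntegrableOn (fun t => (∫ r in Ioc 0 t, α r) * β t) (Ioc 0 T) := by
      have : (fun t => (∫ r in Ioc 0 t, α r) * β t) =ᵐ[volume.restrict (Ioc 0 T)]
          fun t => A t * β t - A₀ * β t := by
        filter_upwards [ae_restrict_mem measurableSet_Ioc] with t ht
        rw [hA t ⟨ht.1.le, ht.2⟩]; ring
      exact (hAβ.sub (hβ.const_mul _)).congr this.symm
    have hi2 : IntegrableOn (fun t => β t * ∫ r in Ioc t T, α r) (Ioc 0 T) := by
      have : (fun t => β t * ∫ r in Ioc t T, α r) =ᵐ[volume.restrict (Ioc 0 T)]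
          fun t => (A T - A₀) * β t - (∫ r in Ioc 0 t, α r) * β t := by
        filter_upwards [ae_restrict_mem measurableSet_Ioc] with t ht
        have hsplit : ∫ r in Ioc 0 T, α r = (∫ r in Ioc 0 t, α r) + ∫ r in Ioc t T, α r := by
          rw [← setIntegral_union (Ioc_disjoint_Ioc_of_le le_rfl) measurableSet_Ioc
            (hα.mono_set (Ioc_subset_Ioc_right ht.2)) (hα.mono_set (Ioc_subset_Ioc_left ht.1.le)),
            Ioc_union_Ioc_eq_Ioc ht.1.le ht.2]
        rw [hA T hTm, add_sub_cancel_left, hsplit]; ring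
      exact (((hβ.const_mul _)).sub hi1).congr this.symm
    rw [← integral_add hi2 hi1, ← integral_const_mul]
    refine integral_congr_ae ?_
    filter_upwards [ae_restrict_mem measurableSet_Ioc] with t ht
    have hsplit : ∫ r in Ioc 0 T, α r = (∫ r in Ioc 0 t, α r) + ∫ r in Ioc t T, α r := by
      rw [← setIntegral_union (Ioc_disjoint_Ioc_of_le le_rfl) measurableSet_Ioc
        (hα.mono_set (Ioc_subset_Ioc_right ht.2)) (hα.mono_set (Ioc_subset_Ioc_left ht.1.le)),
        Ioc_union_Ioc_eq_Ioc ht.1.le ht.2]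
    rw [hA T hTm, add_sub_cancel_left, hsplit]; ring
  have hAT : A T - A₀ = ∫ t in Ioc 0 T, α t := by rw [hA T hTm]; ring
  rw [hAT] at h3
  rw [integral_add hαB hAβ, h1, h2, hA T hTm, hB T hTm]
  linear_combination -h3

end Triangle

/-! ### Finiteness of the Volterra iteration for a bounded potential -/

section Finite

variable {w : ℝ → ℝ≥0∞} {M : ℝ}

/-- `∫_0^r (M/2) s e^{Ms²/4} ds = e^{Mr²/4} - 1`. [folklore] -/
theorem integral_exp_bound (M : ℝ) {r : ℝ} (hr : 0 ≤ r) :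
    ∫ s in Ioc 0 r, M / 2 * (s * Real.exp (M * s ^ 2 / 4)) = Real.exp (M * r ^ 2 / 4) - 1 := by
  have hderiv : ∀ s ∈ uIcc 0 r, HasDerivAt (fun s => Real.exp (M * s ^ 2 / 4))
      (M / 2 * (s * Real.exp (M * s ^ 2 / 4))) s := by
    intro s _
    have h1 : HasDerivAt (fun s => M * s ^ 2 / 4) (M * (2 * s) / 4) s := by
      have := ((hasDerivAt_id s).pow 2).const_mul M |>.div_const 4
      simpa using this
    have h2 := h1.exp
    refine h2.congr_deriv ?_
    ring
  have hcont : Continuous fun s => M / 2 * (s * Real.exp (M * s ^ 2 / 4)) := by fun_prop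
  have h := intervalIntegral.integral_eq_sub_of_hasDerivAt hderiv (hcont.intervalIntegrable _ _)
  rw [intervalIntegral.integral_of_le hr] at h
  rw [h]
  simp

/-- **A priori bound**: for `w ≤ M`, `u_k(r) ≤ r e^{Mr²/4}` (`r e^{Mr²/4}` is a supersolution of the
Volterra equation). [cite: LSSY2005, (2.4)] -/
theorem radialIter_le_exp (hw : Measurable w) (hM : ∀ r, w r ≤ ENNReal.ofReal M) (hM0 : 0 ≤ M) :
    ∀ (k : ℕ) {r : ℝ}, 0 ≤ r → radialIter w k r ≤ ENNReal.ofReal (r * Real.exp (M * r ^ 2 / 4))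
  | 0, r, hr => by
      rw [radialIter_zero]
      exact ENNReal.ofReal_le_ofReal (le_mul_of_one_le_right hr (Real.one_le_exp (by positivity)))
  | k + 1, r, hr => by
      have hb : ∀ s ∈ Ioc 0 r, ENNReal.ofReal (r - s) * (2⁻¹ * w s) * radialIter w k s ≤
          ENNReal.ofReal r * ENNReal.ofReal (M / 2 * (s * Real.exp (M * s ^ 2 / 4))) := by
        intro s hs
        have h1 : ENNReal.ofReal (r - s) ≤ ENNReal.ofReal r := ENNReal.ofReal_le_ofReal (by linarith [hs.1])
        have h2 : 2⁻¹ * w s ≤ ENNReal.ofReal (M / 2) := by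
          calc 2⁻¹ * w s ≤ 2⁻¹ * ENNReal.ofReal M := by gcongr; exact hM s
            _ = ENNReal.ofReal (2⁻¹ * M) := by
                rw [ENNReal.ofReal_mul (by norm_num), ENNReal.ofReal_inv_of_pos two_pos, ENNReal.ofReal_ofNat]
            _ = ENNReal.ofReal (M / 2) := by ring_nf
        have h3 := radialIter_le_exp hw hM hM0 k hs.1.le
        calc ENNReal.ofReal (r - s) * (2⁻¹ * w s) * radialIter w k s
            ≤ ENNReal.ofReal r * ENNReal.ofReal (M / 2) * ENNReal.ofReal (s * Real.exp (M * s ^ 2 / 4)) := by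
              gcongr
          _ = ENNReal.ofReal r * ENNReal.ofReal (M / 2 * (s * Real.exp (M * s ^ 2 / 4))) := by
              rw [mul_assoc, ← ENNReal.ofReal_mul (by positivity)]
      have hint : IntegrableOn (fun s => M / 2 * (s * Real.exp (M * s ^ 2 / 4))) (Ioc 0 r) :=
        (Continuous.integrableOn_Icc (by fun_prop)).mono_set Ioc_subset_Icc_self
      have hnn : 0 ≤ᵐ[volume.restrict (Ioc 0 r)] fun s => M / 2 * (s * Real.exp (M * s ^ 2 / 4)) := by
        filter_upwards [ae_restrict_mem measurableSet_Ioc] with s hs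
        have := hs.1.le
        positivity
      calc radialIter w (k + 1) r
          = ENNReal.ofReal r + ∫⁻ s in Ioc 0 r, ENNReal.ofReal (r - s) * (2⁻¹ * w s) * radialIter w k s :=
            radialIter_succ w k r
        _ ≤ ENNReal.ofReal r + ∫⁻ s in Ioc 0 r,
              ENNReal.ofReal r * ENNReal.ofReal (M / 2 * (s * Real.exp (M * s ^ 2 / 4))) := by
            gcongr 1
            exact setLIntegral_mono' measurableSet_Ioc hb
        _ = ENNReal.ofReal r + ENNReal.ofReal r * ENNReal.ofReal (Real.exp (M * r ^ 2 / 4) - 1) := by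
            rw [lintegral_const_mul _ (by fun_prop), ← ofReal_integral_eq_lintegral_ofReal hint hnn,
              integral_exp_bound M hr]
        _ = ENNReal.ofReal (r * Real.exp (M * r ^ 2 / 4)) := by
            rw [← ENNReal.ofReal_mul hr, ← ENNReal.ofReal_add hr
              (mul_nonneg hr (by linarith [Real.one_le_exp (show 0 ≤ M * r ^ 2 / 4 by positivity)]))]
            ring_nf

/-- **Finiteness**: for a bounded potential the regular solution is finite, `u(r) ≤ r e^{Mr²/4}`.
[cite: LSSY2005, (2.4)] -/
theorem radialSolE_le_exp (hw : Measurable w) (hM : ∀ r, w r ≤ ENNReal.ofReal M) (hM0 : 0 ≤ M)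
    {r : ℝ} (hr : 0 ≤ r) : radialSolE w r ≤ ENNReal.ofReal (r * Real.exp (M * r ^ 2 / 4)) :=
  iSup_le fun k => radialIter_le_exp hw hM hM0 k hr

/-- `u(r) < ∞` for a bounded potential. [cite: LSSY2005, (2.4)] -/
theorem radialSolE_ne_top (hw : Measurable w) (hM : ∀ r, w r ≤ ENNReal.ofReal M) (hM0 : 0 ≤ M) (r : ℝ) :
    radialSolE w r ≠ ⊤ := by
  rcases le_or_gt r 0 with hr | hr
  · rw [radialSolE_of_nonpos w hr]; exact ENNReal.zero_ne_top
  · exact ne_top_of_le_ne_top ENNReal.ofReal_ne_top (radialSolE_le_exp hw hM hM0 hr.le)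

/-- `u = ofReal (u.toReal)`. [cite: LSSY2005, (2.4)] -/
theorem ofReal_radialSol (hw : Measurable w) (hM : ∀ r, w r ≤ ENNReal.ofReal M) (hM0 : 0 ≤ M) (r : ℝ) :
    ENNReal.ofReal (radialSol w r) = radialSolE w r :=
  ENNReal.ofReal_toReal (radialSolE_ne_top hw hM hM0 r)

/-- `0 ≤ u`. [cite: LSSY2005, (2.4)] -/
theorem radialSol_nonneg (w : ℝ → ℝ≥0∞) (r : ℝ) : 0 ≤ radialSol w r := ENNReal.toReal_nonneg

/-- `r ≤ u(r)`. [cite: LSSY2005, (2.4)] -/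
theorem le_radialSol (hw : Measurable w) (hM : ∀ r, w r ≤ ENNReal.ofReal M) (hM0 : 0 ≤ M) (r : ℝ) :
    r ≤ radialSol w r := by
  rcases le_or_gt r 0 with hr | hr
  · exact hr.trans (radialSol_nonneg w r)
  · have h := ofReal_le_radialSolE w r
    rw [← ofReal_radialSol hw hM hM0] at h
    exact (ENNReal.ofReal_le_ofReal_iff (radialSol_nonneg w r)).mp h

/-- `u(r) ≤ r e^{Mr²/4}` (real form). [cite: LSSY2005, (2.4)] -/
theorem radialSol_le_exp (hw : Measurable w) (hM : ∀ r, w r ≤ ENNReal.ofReal M) (hM0 : 0 ≤ M)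
    {r : ℝ} (hr : 0 ≤ r) : radialSol w r ≤ r * Real.exp (M * r ^ 2 / 4) := by
  have h := radialSolE_le_exp hw hM hM0 hr
  rw [← ofReal_radialSol hw hM hM0] at h
  exact (ENNReal.ofReal_le_ofReal_iff (by positivity)).mp h

/-- `u(r) = 0` for `r ≤ 0` (real form). [cite: LSSY2005, (2.4)] -/
theorem radialSol_of_nonpos (w : ℝ → ℝ≥0∞) {r : ℝ} (hr : r ≤ 0) : radialSol w r = 0 := by
  rw [radialSol, radialSolE_of_nonpos w hr, ENNReal.toReal_zero]

/-- A uniform bound on `[0, T]`: `u(s) ≤ T e^{MT²/4}` for `s ≤ T`. [cite: LSSY2005, (2.4)] -/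
theorem radialSol_le_bound (hw : Measurable w) (hM : ∀ r, w r ≤ ENNReal.ofReal M) (hM0 : 0 ≤ M)
    {T s : ℝ} (hs : s ≤ T) (hT : 0 ≤ T) : radialSol w s ≤ T * Real.exp (M * T ^ 2 / 4) := by
  rcases le_or_gt s 0 with h0 | h0
  · rw [radialSol_of_nonpos w h0]; positivity
  · calc radialSol w s ≤ s * Real.exp (M * s ^ 2 / 4) := radialSol_le_exp hw hM hM0 h0.le
      _ ≤ T * Real.exp (M * T ^ 2 / 4) := by gcongr

/-- `u` is measurable. [cite: LSSY2005, (2.4)] -/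
theorem measurable_radialSol (hw : Measurable w) : Measurable (radialSol w) :=
  (measurable_radialSolE hw).ennreal_toReal

/-- `0 ≤ W ≤ M`. [folklore] -/
theorem toReal_pot_le (hM : ∀ r, w r ≤ ENNReal.ofReal M) (hM0 : 0 ≤ M) (r : ℝ) : (w r).toReal ≤ M :=
  ENNReal.toReal_le_of_le_ofReal hM0 (hM r)

/-- `w = ofReal W` (the potential is finite). [folklore] -/
theorem ofReal_toReal_pot (hM : ∀ r, w r ≤ ENNReal.ofReal M) (r : ℝ) : ENNReal.ofReal (w r).toReal = w r :=
  ENNReal.ofReal_toReal (ne_top_of_le_ne_top ENNReal.ofReal_ne_top (hM r))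

end Finite

/-! ### The Volterra equation in real form; `u'`, `u = ∫ u'` -/

section Volterra

variable {w : ℝ → ℝ≥0∞} {M : ℝ}

/-- A bounded measurable function is integrable on `(a, b]`. [folklore] -/
theorem integrableOn_Ioc_of_bound {F : ℝ → ℝ} {a b C : ℝ} (hF : Measurable F)
    (hb : ∀ s ∈ Ioc a b, |F s| ≤ C) : IntegrableOn F (Ioc a b) := by
  refine Measure.integrableOn_of_bounded (M := C) (by rw [Real.volume_Ioc]; exact ENNReal.ofReal_ne_top)
    hF.aestronglyMeasurable ?_
  filter_upwards [ae_restrict_mem measurableSet_Ioc] with s hs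
  rw [Real.norm_eq_abs]; exact hb s hs

/-- `∫⁻_{(a,b]} ofReal F = ofReal ∫_{(a,b]} F` for a bounded measurable `F ≥ 0`. [folklore] -/
theorem lintegral_Ioc_eq_ofReal {F : ℝ → ℝ} {G : ℝ → ℝ≥0∞} {a b C : ℝ} (hF : Measurable F)
    (hG : ∀ s ∈ Ioc a b, G s = ENNReal.ofReal (F s)) (h0 : ∀ s ∈ Ioc a b, 0 ≤ F s)
    (hC : ∀ s ∈ Ioc a b, F s ≤ C) :
    ∫⁻ s in Ioc a b, G s = ENNReal.ofReal (∫ s in Ioc a b, F s) := by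
  rw [setLIntegral_congr_fun measurableSet_Ioc hG, ← ofReal_integral_eq_lintegral_ofReal]
  · exact integrableOn_Ioc_of_bound hF fun s hs => by
      rw [abs_of_nonneg (h0 s hs)]; exact hC s hs
  · filter_upwards [ae_restrict_mem measurableSet_Ioc] with s hs using h0 s hs

/-- **The Volterra equation** for `u = sup_k u_k` in `[0, ∞]` (monotone convergence):
`u(r) = r + ½∫_0^r (r-s) w(s) u(s) ds`. [cite: LSSY2005, (2.4)] -/
theorem radialSolE_eq (hw : Measurable w) (r : ℝ) :
    radialSolE w r = ENNReal.ofReal r +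
      ∫⁻ s in Ioc 0 r, ENNReal.ofReal (r - s) * (2⁻¹ * w s) * radialSolE w s := by
  have hmono : Monotone fun k => radialIter w k r := monotone_radialIter w r
  have hmeas : ∀ k, Measurable fun s => ENNReal.ofReal (r - s) * (2⁻¹ * w s) * radialIter w k s :=
    fun k => ((ENNReal.measurable_ofReal.comp (measurable_const.sub measurable_id)).mul
      (hw.const_mul _)).mul (measurable_radialIter hw k)
  rw [radialSolE, ← hmono.iSup_nat_add 1]
  simp only [radialIter_succ]
  rw [← ENNReal.add_iSup, ← lintegral_iSup hmeas]
  · congr 1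
    refine lintegral_congr fun s => ?_
    rw [← ENNReal.mul_iSup]
    rfl
  · intro j k hjk s
    exact mul_le_mul_right (monotone_radialIter w s hjk) _

/-- **The Volterra equation in real form**: for a bounded potential and `r ≥ 0`,
`u(r) = r + ∫_0^r (r-s) (W(s)/2) u(s) ds`, `W = w.toReal`. [cite: LSSY2005, (2.4)] -/
theorem radialSol_eq (hw : Measurable w) (hM : ∀ r, w r ≤ ENNReal.ofReal M) (hM0 : 0 ≤ M)
    {r : ℝ} (hr : 0 ≤ r) :
    radialSol w r = r + ∫ s in Ioc 0 r, (r - s) * ((w s).toReal / 2) * radialSol w s := by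
  have hlin : ∫⁻ s in Ioc 0 r, ENNReal.ofReal (r - s) * (2⁻¹ * w s) * radialSolE w s =
      ENNReal.ofReal (∫ s in Ioc 0 r, (r - s) * ((w s).toReal / 2) * radialSol w s) := by
    refine lintegral_Ioc_eq_ofReal (C := r * (M / 2) * (r * Real.exp (M * r ^ 2 / 4)))
      (((measurable_const.sub measurable_id).mul (hw.ennreal_toReal.div_const 2)).mul
        (measurable_radialSol hw)) (fun s hs => ?_) (fun s hs => ?_) (fun s hs => ?_)
    · have hrs : 0 ≤ r - s := by linarith [hs.2]
      have hW : 0 ≤ (w s).toReal := ENNReal.toReal_nonneg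
      rw [← ofReal_radialSol hw hM hM0 s, ENNReal.ofReal_mul (by positivity), ENNReal.ofReal_mul hrs]
      congr 1
      rw [← ofReal_toReal_pot hM s, ENNReal.toReal_ofReal ENNReal.toReal_nonneg, ENNReal.ofReal_div_of_pos two_pos,
        ENNReal.ofReal_ofNat, ENNReal.div_eq_inv_mul]
    · have : 0 ≤ (w s).toReal := ENNReal.toReal_nonneg
      have := radialSol_nonneg w s
      have : 0 ≤ r - s := by linarith [hs.2]
      positivity
    · have h1 : r - s ≤ r := by linarith [hs.1]
      have h2 : (w s).toReal / 2 ≤ M / 2 := by linarith [toReal_pot_le hM hM0 s]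
      have h3 := radialSol_le_bound hw hM hM0 hs.2 hr
      have : 0 ≤ (w s).toReal := ENNReal.toReal_nonneg
      have := radialSol_nonneg w s
      have : 0 ≤ r - s := by linarith [hs.2]
      exact mul_le_mul (mul_le_mul h1 h2 (by positivity) hr) h3 (radialSol_nonneg w s) (by positivity)
  have hnn : 0 ≤ ∫ s in Ioc 0 r, (r - s) * ((w s).toReal / 2) * radialSol w s :=
    setIntegral_nonneg measurableSet_Ioc fun s hs => by
      have : 0 ≤ (w s).toReal := ENNReal.toReal_nonneg
      have := radialSol_nonneg w s
      have : 0 ≤ r - s := by linarith [hs.2]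
      positivity
  rw [radialSol, radialSolE_eq hw r, hlin, ENNReal.toReal_add ENNReal.ofReal_ne_top ENNReal.ofReal_ne_top,
    ENNReal.toReal_ofReal hr, ENNReal.toReal_ofReal hnn]

/-- The integrand `G = (W/2) u` of `u'` is measurable. [cite: LSSY2005, (2.4)] -/
theorem measurable_derivIntegrand (hw : Measurable w) :
    Measurable fun s => (w s).toReal / 2 * radialSol w s :=
  (hw.ennreal_toReal.div_const 2).mul (measurable_radialSol hw)

/-- `0 ≤ G`. [cite: LSSY2005, (2.4)] -/
theorem derivIntegrand_nonneg (w : ℝ → ℝ≥0∞) (s : ℝ) : 0 ≤ (w s).toReal / 2 * radialSol w s :=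
  mul_nonneg (div_nonneg ENNReal.toReal_nonneg zero_le_two) (radialSol_nonneg w s)

/-- `G = 0` on `(-∞, 0]`. [cite: LSSY2005, (2.4)] -/
theorem derivIntegrand_of_nonpos (w : ℝ → ℝ≥0∞) {s : ℝ} (hs : s ≤ 0) : (w s).toReal / 2 * radialSol w s = 0 := by
  rw [radialSol_of_nonpos w hs, mul_zero]

/-- `G ≤ (M/2) T e^{MT²/4}` on `(-∞, T]`. [cite: LSSY2005, (2.4)] -/
theorem derivIntegrand_le (hw : Measurable w) (hM : ∀ r, w r ≤ ENNReal.ofReal M) (hM0 : 0 ≤ M)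
    {T s : ℝ} (hs : s ≤ T) (hT : 0 ≤ T) :
    (w s).toReal / 2 * radialSol w s ≤ M / 2 * (T * Real.exp (M * T ^ 2 / 4)) := by
  have h1 : (w s).toReal / 2 ≤ M / 2 := by linarith [toReal_pot_le hM hM0 s]
  have h2 := radialSol_le_bound hw hM hM0 hs hT
  have : 0 ≤ (w s).toReal / 2 := div_nonneg ENNReal.toReal_nonneg zero_le_two
  have := radialSol_nonneg w s
  gcongr

/-- `G` is integrable on every bounded interval. [cite: LSSY2005, (2.4)] -/
theorem intervalIntegrable_derivIntegrand (hw : Measurable w) (hM : ∀ r, w r ≤ ENNReal.ofReal M)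
    (hM0 : 0 ≤ M) (a b : ℝ) :
    IntervalIntegrable (fun s => (w s).toReal / 2 * radialSol w s) volume a b := by
  have key : ∀ a b : ℝ, IntegrableOn (fun s => (w s).toReal / 2 * radialSol w s) (Ioc a b) := by
    intro a b
    refine integrableOn_Ioc_of_bound (C := M / 2 * (max b 0 * Real.exp (M * max b 0 ^ 2 / 4)))
      (measurable_derivIntegrand hw) fun s hs => ?_
    rw [abs_of_nonneg (derivIntegrand_nonneg w s)]
    exact derivIntegrand_le hw hM hM0 (hs.2.trans (le_max_left _ _)) (le_max_right _ _)
  exact (intervalIntegrable_iff).mpr (by rw [uIoc]; exact key _ _)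

/-- `G` is integrable on `(a, b]`. [cite: LSSY2005, (2.4)] -/
theorem integrableOn_derivIntegrand (hw : Measurable w) (hM : ∀ r, w r ≤ ENNReal.ofReal M)
    (hM0 : 0 ≤ M) {a b : ℝ} (hab : a ≤ b) :
    IntegrableOn (fun s => (w s).toReal / 2 * radialSol w s) (Ioc a b) := by
  have h := intervalIntegrable_derivIntegrand hw hM hM0 a b
  rw [intervalIntegrable_iff, uIoc_of_le hab] at h
  exact h

/-- **The derivative in real form**: `u'(r) = 1 + ∫_0^r (W/2) u`. [cite: LSSY2005, (2.4)–(2.5)] -/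
theorem radialSolDeriv_eq (hw : Measurable w) (hM : ∀ r, w r ≤ ENNReal.ofReal M) (hM0 : 0 ≤ M) (r : ℝ) :
    radialSolDeriv w r = 1 + ∫ s in Ioc 0 r, (w s).toReal / 2 * radialSol w s := by
  have hlin : ∫⁻ s in Ioc 0 r, 2⁻¹ * w s * radialSolE w s =
      ENNReal.ofReal (∫ s in Ioc 0 r, (w s).toReal / 2 * radialSol w s) := by
    refine lintegral_Ioc_eq_ofReal (C := M / 2 * (max r 0 * Real.exp (M * max r 0 ^ 2 / 4)))
      (measurable_derivIntegrand hw) (fun s hs => ?_) (fun s _ => derivIntegrand_nonneg w s)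
      (fun s hs => derivIntegrand_le hw hM hM0 (hs.2.trans (le_max_left _ _)) (le_max_right _ _))
    rw [← ofReal_radialSol hw hM hM0 s, ENNReal.ofReal_mul (div_nonneg ENNReal.toReal_nonneg zero_le_two)]
    congr 1
    rw [← ofReal_toReal_pot hM s, ENNReal.toReal_ofReal ENNReal.toReal_nonneg, ENNReal.ofReal_div_of_pos two_pos,
      ENNReal.ofReal_ofNat, ENNReal.div_eq_inv_mul]
  rw [radialSolDeriv, hlin, ENNReal.toReal_ofReal (setIntegral_nonneg measurableSet_Ioc fun s _ =>
    derivIntegrand_nonneg w s)]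

/-- `u'(r) = 1 + ∫_0^r G` as an interval integral (all `r`; `G = 0` on the negative axis).
[cite: LSSY2005, (2.4)–(2.5)] -/
theorem radialSolDeriv_eq_intervalIntegral (hw : Measurable w) (hM : ∀ r, w r ≤ ENNReal.ofReal M)
    (hM0 : 0 ≤ M) (r : ℝ) :
    radialSolDeriv w r = 1 + ∫ s in (0 : ℝ)..r, (w s).toReal / 2 * radialSol w s := by
  rw [radialSolDeriv_eq hw hM hM0]
  rcases le_or_gt 0 r with hr | hr
  · rw [intervalIntegral.integral_of_le hr]
  · rw [intervalIntegral.integral_of_ge hr.le, Ioc_eq_empty (not_lt.mpr hr.le), Measure.restrict_empty,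
      integral_zero_measure, setIntegral_eq_zero_of_forall_eq_zero fun s hs => derivIntegrand_of_nonpos w hs.2,
      neg_zero]

/-- `u'` is continuous. [cite: LSSY2005, (2.4)–(2.5)] -/
theorem continuous_radialSolDeriv (hw : Measurable w) (hM : ∀ r, w r ≤ ENNReal.ofReal M) (hM0 : 0 ≤ M) :
    Continuous (radialSolDeriv w) := by
  have h := intervalIntegral.continuous_primitive (intervalIntegrable_derivIntegrand hw hM hM0) 0
  have heq : radialSolDeriv w = fun r => 1 + ∫ s in (0 : ℝ)..r, (w s).toReal / 2 * radialSol w s :=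
    funext (radialSolDeriv_eq_intervalIntegral hw hM hM0)
  rw [heq]
  exact continuous_const.add h

/-- `1 ≤ u'`. [cite: LSSY2005, (2.4)–(2.5)] -/
theorem one_le_radialSolDeriv (hw : Measurable w) (hM : ∀ r, w r ≤ ENNReal.ofReal M) (hM0 : 0 ≤ M) (r : ℝ) :
    1 ≤ radialSolDeriv w r := by
  rw [radialSolDeriv_eq hw hM hM0]
  have h0 : 0 ≤ ∫ s in Ioc 0 r, (w s).toReal / 2 * radialSol w s :=
    setIntegral_nonneg measurableSet_Ioc fun s _ => derivIntegrand_nonneg w s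
  linarith

/-- `0 < u'`. [cite: LSSY2005, (2.4)–(2.5)] -/
theorem radialSolDeriv_pos (hw : Measurable w) (hM : ∀ r, w r ≤ ENNReal.ofReal M) (hM0 : 0 ≤ M) (r : ℝ) :
    0 < radialSolDeriv w r :=
  one_pos.trans_le (one_le_radialSolDeriv hw hM hM0 r)

/-- `u'` is non-decreasing (`u'' = ½Wu ≥ 0`). [cite: LSSY2005, (2.4)–(2.5)] -/
theorem monotone_radialSolDeriv (hw : Measurable w) (hM : ∀ r, w r ≤ ENNReal.ofReal M) (hM0 : 0 ≤ M) :
    Monotone (radialSolDeriv w) := by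
  intro r₁ r₂ h
  rw [radialSolDeriv_eq hw hM hM0, radialSolDeriv_eq hw hM hM0]
  gcongr 1
  rcases le_or_gt 0 r₂ with h2 | h2
  · exact setIntegral_mono_set (integrableOn_derivIntegrand hw hM hM0 h2)
      (Eventually.of_forall fun s => derivIntegrand_nonneg w s) (Ioc_subset_Ioc_right h).eventuallyLE
  · rw [Ioc_eq_empty (not_lt.mpr (h.trans h2.le)), Ioc_eq_empty (not_lt.mpr h2.le)]

/-- **`u = ∫ u'`**: `u(r) = ∫_0^r u'(s) ds` for `r ≥ 0` (Fubini on the triangle).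
[cite: LSSY2005, (2.4)–(2.5)] -/
theorem radialSol_eq_integral_deriv (hw : Measurable w) (hM : ∀ r, w r ≤ ENNReal.ofReal M) (hM0 : 0 ≤ M)
    {r : ℝ} (hr : 0 ≤ r) : radialSol w r = ∫ s in Ioc 0 r, radialSolDeriv w s := by
  have hG := integrableOn_derivIntegrand hw hM hM0 hr
  have heq : ∀ s ∈ Ioc 0 r, radialSolDeriv w s = 1 + ∫ t in Ioc 0 s, (w t).toReal / 2 * radialSol w t :=
    fun s _ => radialSolDeriv_eq hw hM hM0 s
  have hprim : IntegrableOn (fun s => ∫ t in Ioc 0 s, (w t).toReal / 2 * radialSol w t) (Ioc 0 r) := by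
    refine integrableOn_Ioc_of_bound (C := ∫ t in Ioc 0 r, (w t).toReal / 2 * radialSol w t) ?_ fun s hs => ?_
    · have hc := continuous_radialSolDeriv hw hM hM0
      have : (fun s => ∫ t in Ioc 0 s, (w t).toReal / 2 * radialSol w t) = fun s => radialSolDeriv w s - 1 := by
        funext s; rw [radialSolDeriv_eq hw hM hM0]; ring
      rw [this]; exact (hc.sub continuous_const).measurable
    · rw [abs_of_nonneg (setIntegral_nonneg measurableSet_Ioc fun t _ => derivIntegrand_nonneg w t)]
      exact setIntegral_mono_set hG (Eventually.of_forall fun t => derivIntegrand_nonneg w t)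
        (Ioc_subset_Ioc_right hs.2).eventuallyLE
  have h1 : IntegrableOn (fun _ : ℝ => (1 : ℝ)) (Ioc 0 r) :=
    integrableOn_const (by rw [Real.volume_Ioc]; exact ENNReal.ofReal_ne_top)
  rw [setIntegral_congr_fun measurableSet_Ioc heq, integral_add h1 hprim, setIntegral_const,
    Real.volume_real_Ioc_of_le hr, sub_zero, smul_eq_mul, mul_one, setIntegral_Ioc_primitive hG,
    radialSol_eq hw hM hM0 hr]
  congr 1
  refine setIntegral_congr_fun measurableSet_Ioc fun s _ => ?_
  ring

/-- `u(r) = ∫_0^r u'` as an interval integral, `r ≥ 0`. [cite: LSSY2005, (2.4)–(2.5)] -/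
theorem radialSol_eq_intervalIntegral_deriv (hw : Measurable w) (hM : ∀ r, w r ≤ ENNReal.ofReal M)
    (hM0 : 0 ≤ M) {r : ℝ} (hr : 0 ≤ r) : radialSol w r = ∫ s in (0 : ℝ)..r, radialSolDeriv w s := by
  rw [intervalIntegral.integral_of_le hr, radialSol_eq_integral_deriv hw hM hM0 hr]

/-- **`u` is differentiable on `(0, ∞)` with derivative `u'`**. [cite: LSSY2005, (2.4)–(2.5)] -/
theorem hasDerivAt_radialSol (hw : Measurable w) (hM : ∀ r, w r ≤ ENNReal.ofReal M) (hM0 : 0 ≤ M)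
    {r : ℝ} (hr : 0 < r) : HasDerivAt (radialSol w) (radialSolDeriv w r) r := by
  have hc := continuous_radialSolDeriv hw hM hM0
  have h := intervalIntegral.integral_hasDerivAt_right (hc.intervalIntegrable 0 r)
    (hc.stronglyMeasurableAtFilter _ _) hc.continuousAt
  refine h.congr_of_eventuallyEq ?_
  filter_upwards [Ioi_mem_nhds hr] with s hs
  exact radialSol_eq_intervalIntegral_deriv hw hM hM0 (le_of_lt hs)

/-- `u` is continuous on `(0, ∞)`. [cite: LSSY2005, (2.4)–(2.5)] -/
theorem continuousAt_radialSol (hw : Measurable w) (hM : ∀ r, w r ≤ ENNReal.ofReal M) (hM0 : 0 ≤ M)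
    {r : ℝ} (hr : 0 < r) : ContinuousAt (radialSol w) r :=
  (hasDerivAt_radialSol hw hM hM0 hr).continuousAt

/-- `u(r) ≤ r u'(r)` (`u'` is non-decreasing). [cite: LSSY2005, (2.4)–(2.5)] -/
theorem radialSol_le_mul_deriv (hw : Measurable w) (hM : ∀ r, w r ≤ ENNReal.ofReal M) (hM0 : 0 ≤ M)
    {r : ℝ} (hr : 0 ≤ r) : radialSol w r ≤ r * radialSolDeriv w r := by
  rw [radialSol_eq_integral_deriv hw hM hM0 hr]
  have hc := continuous_radialSolDeriv hw hM hM0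
  calc ∫ s in Ioc 0 r, radialSolDeriv w s ≤ ∫ _ in Ioc 0 r, radialSolDeriv w r := by
        refine setIntegral_mono_on (hc.integrableOn_Icc.mono_set Ioc_subset_Icc_self)
          (integrableOn_const (by rw [Real.volume_Ioc]; exact ENNReal.ofReal_ne_top)) measurableSet_Ioc
          fun s hs => monotone_radialSolDeriv hw hM hM0 hs.2
    _ = r * radialSolDeriv w r := by
        rw [setIntegral_const, Real.volume_real_Ioc_of_le hr, sub_zero, smul_eq_mul]

/-- `u` is non-decreasing on `[0, ∞)`. [cite: LSSY2005, (2.4)–(2.5)] -/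
theorem radialSol_mono (hw : Measurable w) (hM : ∀ r, w r ≤ ENNReal.ofReal M) (hM0 : 0 ≤ M)
    {r₁ r₂ : ℝ} (h1 : 0 ≤ r₁) (h : r₁ ≤ r₂) : radialSol w r₁ ≤ radialSol w r₂ := by
  rw [radialSol_eq_integral_deriv hw hM hM0 h1, radialSol_eq_integral_deriv hw hM hM0 (h1.trans h)]
  have hc := continuous_radialSolDeriv hw hM hM0
  exact setIntegral_mono_set (hc.integrableOn_Icc.mono_set Ioc_subset_Icc_self)
    (Eventually.of_forall fun s => (radialSolDeriv_pos hw hM hM0 s).le) (Ioc_subset_Ioc_right h).eventuallyLE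

/-- `0 < u(r)` for `r > 0`. [cite: LSSY2005, (2.4)] -/
theorem radialSol_pos (hw : Measurable w) (hM : ∀ r, w r ≤ ENNReal.ofReal M) (hM0 : 0 ≤ M)
    {r : ℝ} (hr : 0 < r) : 0 < radialSol w r :=
  hr.trans_le (le_radialSol hw hM hM0 r)

/-- **The flux identity** `r u'(r) - u(r) = ∫_0^r s (W(s)/2) u(s) ds` (`= r² f'(r) · u'(R)`), `r ≥ 0`.
[cite: LSSY2005, (2.4)–(2.5)] -/
theorem mul_deriv_sub_sol_eq (hw : Measurable w) (hM : ∀ r, w r ≤ ENNReal.ofReal M) (hM0 : 0 ≤ M)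
    {r : ℝ} (hr : 0 ≤ r) :
    r * radialSolDeriv w r - radialSol w r = ∫ s in Ioc 0 r, s * ((w s).toReal / 2 * radialSol w s) := by
  have hG := integrableOn_derivIntegrand hw hM hM0 hr
  have hsG : IntegrableOn (fun s => s * ((w s).toReal / 2 * radialSol w s)) (Ioc 0 r) := by
    refine integrableOn_Ioc_of_bound (C := r * (M / 2 * (r * Real.exp (M * r ^ 2 / 4))))
      (measurable_id.mul (measurable_derivIntegrand hw)) fun s hs => ?_
    rw [abs_of_nonneg (mul_nonneg hs.1.le (derivIntegrand_nonneg w s))]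
    exact mul_le_mul hs.2 (derivIntegrand_le hw hM hM0 hs.2 hr) (derivIntegrand_nonneg w s) hr
  rw [radialSolDeriv_eq hw hM hM0, radialSol_eq hw hM hM0 hr]
  have h3 : ∫ s in Ioc 0 r, (r - s) * ((w s).toReal / 2) * radialSol w s =
      ∫ s in Ioc 0 r, (r * ((w s).toReal / 2 * radialSol w s) - s * ((w s).toReal / 2 * radialSol w s)) :=
    setIntegral_congr_fun measurableSet_Ioc fun s _ => by ring
  rw [h3, integral_sub (hG.const_mul r) hsG, integral_const_mul]
  ring

/-- `0 ≤ r u'(r) - u(r) ≤ (M/2) r² u(r)` for `r ≥ 0`. [cite: LSSY2005, (2.4)–(2.5)] -/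
theorem mul_deriv_sub_sol_bounds (hw : Measurable w) (hM : ∀ r, w r ≤ ENNReal.ofReal M) (hM0 : 0 ≤ M)
    {r : ℝ} (hr : 0 ≤ r) :
    0 ≤ r * radialSolDeriv w r - radialSol w r ∧
      r * radialSolDeriv w r - radialSol w r ≤ M / 2 * r ^ 2 * radialSol w r := by
  rw [mul_deriv_sub_sol_eq hw hM hM0 hr]
  refine ⟨setIntegral_nonneg measurableSet_Ioc fun s hs => mul_nonneg hs.1.le (derivIntegrand_nonneg w s), ?_⟩
  have hsG : IntegrableOn (fun s => s * ((w s).toReal / 2 * radialSol w s)) (Ioc 0 r) := by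
    refine integrableOn_Ioc_of_bound (C := r * (M / 2 * (r * Real.exp (M * r ^ 2 / 4))))
      (measurable_id.mul (measurable_derivIntegrand hw)) fun s hs => ?_
    rw [abs_of_nonneg (mul_nonneg hs.1.le (derivIntegrand_nonneg w s))]
    exact mul_le_mul hs.2 (derivIntegrand_le hw hM hM0 hs.2 hr) (derivIntegrand_nonneg w s) hr
  calc ∫ s in Ioc 0 r, s * ((w s).toReal / 2 * radialSol w s)
      ≤ ∫ _ in Ioc 0 r, r * (M / 2 * radialSol w r) := by
        refine setIntegral_mono_on hsG (integrableOn_const (by rw [Real.volume_Ioc]; exact ENNReal.ofReal_ne_top))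
          measurableSet_Ioc fun s hs => ?_
        have h1 : (w s).toReal / 2 ≤ M / 2 := by linarith [toReal_pot_le hM hM0 s]
        have h2 : radialSol w s ≤ radialSol w r := radialSol_mono hw hM hM0 hs.1.le hs.2
        have : 0 ≤ (w s).toReal / 2 := div_nonneg ENNReal.toReal_nonneg zero_le_two
        have := radialSol_nonneg w s
        have := hs.1.le
        gcongr
        exact hs.2
    _ = M / 2 * r ^ 2 * radialSol w r := by
        rw [setIntegral_const, Real.volume_real_Ioc_of_le hr, sub_zero, smul_eq_mul]; ring

end Volterra

/-! ### Beyond the range: `u'` constant, `u` affine -/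

section Range

variable {w : ℝ → ℝ≥0∞} {M ρ : ℝ}

/-- Beyond the range of the potential `u'` is constant: `u'(r) = u'(ρ)` for `r ≥ ρ ≥ 0` if `w = 0`
on `(ρ, ∞)`. [cite: LSSY2005, (2.5)] -/
theorem radialSolDeriv_eq_of_ge (hw : Measurable w) (hM : ∀ r, w r ≤ ENNReal.ofReal M) (hM0 : 0 ≤ M)
    (hρ : 0 ≤ ρ) (hwρ : ∀ s, ρ < s → w s = 0) {r : ℝ} (hr : ρ ≤ r) :
    radialSolDeriv w r = radialSolDeriv w ρ := by
  rw [radialSolDeriv_eq hw hM hM0, radialSolDeriv_eq hw hM hM0, ← Ioc_union_Ioc_eq_Ioc hρ hr,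
    setIntegral_union (Ioc_disjoint_Ioc_of_le le_rfl) measurableSet_Ioc
      (integrableOn_derivIntegrand hw hM hM0 hρ) (integrableOn_derivIntegrand hw hM hM0 hr),
    setIntegral_eq_zero_of_forall_eq_zero (t := Ioc ρ r) fun s hs => by
      rw [hwρ s hs.1, ENNReal.toReal_zero, zero_div, zero_mul],
    add_zero]

/-- Beyond the range `u` is affine: `u(r) = u(ρ) + u'(ρ)(r - ρ)` for `r ≥ ρ ≥ 0`.
[cite: LSSY2005, (2.5)] -/
theorem radialSol_eq_of_ge (hw : Measurable w) (hM : ∀ r, w r ≤ ENNReal.ofReal M) (hM0 : 0 ≤ M)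
    (hρ : 0 ≤ ρ) (hwρ : ∀ s, ρ < s → w s = 0) {r : ℝ} (hr : ρ ≤ r) :
    radialSol w r = radialSol w ρ + radialSolDeriv w ρ * (r - ρ) := by
  have hc := continuous_radialSolDeriv hw hM hM0
  rw [radialSol_eq_integral_deriv hw hM hM0 (hρ.trans hr), radialSol_eq_integral_deriv hw hM hM0 hρ,
    ← Ioc_union_Ioc_eq_Ioc hρ hr,
    setIntegral_union (Ioc_disjoint_Ioc_of_le le_rfl) measurableSet_Ioc
      (hc.integrableOn_Icc.mono_set Ioc_subset_Icc_self) (hc.integrableOn_Icc.mono_set Ioc_subset_Icc_self),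
    setIntegral_congr_fun measurableSet_Ioc (fun s hs => radialSolDeriv_eq_of_ge hw hM hM0 hρ hwρ hs.1.le),
    setIntegral_const, Real.volume_real_Ioc_of_le hr, smul_eq_mul, mul_comm]

end Range

/-! ### The normalised profile `f = u/(u'(R) r)`, the flux `r²f'` and the scattering length -/

section Profile

variable {w : ℝ → ℝ≥0∞} {M R : ℝ}

/-- `0 < u'(R)`. [cite: LSSY2005, (2.5)] -/
theorem slope_pos (hw : Measurable w) (hM : ∀ r, w r ≤ ENNReal.ofReal M) (hM0 : 0 ≤ M) (R : ℝ) :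
    0 < radialSolDeriv w R := radialSolDeriv_pos hw hM hM0 R

/-- **`f = 1 - a/r` beyond the range**: if `w = 0` on `(ρ, ∞)` with `0 ≤ ρ ≤ R`, then
`f(r) = 1 - a/r` for `r > ρ`, `a = R - u(R)/u'(R)`. [cite: LSSY2005, (2.5) and Thm. C.1 (C.7)] -/
theorem radialProfile_eq_one_sub_div (hw : Measurable w) (hM : ∀ r, w r ≤ ENNReal.ofReal M) (hM0 : 0 ≤ M)
    {ρ : ℝ} (hρ : 0 ≤ ρ) (hρR : ρ ≤ R) (hwρ : ∀ s, ρ < s → w s = 0) {r : ℝ} (hr : ρ < r) :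
    radialProfile w R r = 1 - odeScatteringLength w R / r := by
  have hr0 : 0 < r := hρ.trans_lt hr
  have hc := slope_pos hw hM hM0 R
  have hcρ : radialSolDeriv w R = radialSolDeriv w ρ := radialSolDeriv_eq_of_ge hw hM hM0 hρ hwρ hρR
  rw [radialProfile_of_pos w R hr0, odeScatteringLength, radialSol_eq_of_ge hw hM hM0 hρ hwρ hr.le,
    radialSol_eq_of_ge hw hM hM0 hρ hwρ hρR, ← hcρ]
  field_simp
  ring

/-- **The scattering length is the flux at `R`**: `a = (R u'(R) - u(R))/u'(R)`. [cite: LSSY2005, (2.5)] -/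
theorem odeScatteringLength_eq (hw : Measurable w) (hM : ∀ r, w r ≤ ENNReal.ofReal M) (hM0 : 0 ≤ M) (R : ℝ) :
    odeScatteringLength w R = (R * radialSolDeriv w R - radialSol w R) / radialSolDeriv w R := by
  have hc := slope_pos hw hM hM0 R
  rw [odeScatteringLength]
  field_simp

/-- `0 ≤ a`. [cite: LSSY2005, Thm. C.1] -/
theorem odeScatteringLength_nonneg (hw : Measurable w) (hM : ∀ r, w r ≤ ENNReal.ofReal M) (hM0 : 0 ≤ M)
    (hR : 0 ≤ R) : 0 ≤ odeScatteringLength w R := by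
  rw [odeScatteringLength_eq hw hM hM0]
  exact div_nonneg (mul_deriv_sub_sol_bounds hw hM hM0 hR).1 (slope_pos hw hM hM0 R).le

/-- `a < R` (`u(R) > 0`). [cite: LSSY2005, Thm. C.1] -/
theorem odeScatteringLength_lt (hw : Measurable w) (hM : ∀ r, w r ≤ ENNReal.ofReal M) (hM0 : 0 ≤ M)
    (hR : 0 < R) : odeScatteringLength w R < R := by
  rw [odeScatteringLength]
  have := div_pos (radialSol_pos hw hM hM0 hR) (slope_pos hw hM hM0 R)
  linarith

/-- `a ≤ (M/2) R² u(R)/u'(R) ≤ (M/2) R³` — a crude bound. [cite: LSSY2005, Thm. C.1] -/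
theorem odeScatteringLength_le (hw : Measurable w) (hM : ∀ r, w r ≤ ENNReal.ofReal M) (hM0 : 0 ≤ M)
    (hR : 0 ≤ R) : odeScatteringLength w R ≤ M / 2 * R ^ 3 := by
  rw [odeScatteringLength_eq hw hM hM0]
  have hc := slope_pos hw hM hM0 R
  rw [div_le_iff₀ hc]
  have h1 := (mul_deriv_sub_sol_bounds hw hM hM0 hR).2
  have h2 := radialSol_le_mul_deriv hw hM hM0 hR
  have h3 : M / 2 * R ^ 2 * radialSol w R ≤ M / 2 * R ^ 2 * (R * radialSolDeriv w R) := by gcongr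
  nlinarith

/-- **`0 < f`**. [cite: LSSY2005, Thm. C.1 (`f₀ ≥ f > 0`)] -/
theorem radialProfile_pos (hw : Measurable w) (hM : ∀ r, w r ≤ ENNReal.ofReal M) (hM0 : 0 ≤ M) (R r : ℝ) :
    0 < radialProfile w R r := by
  have hc := slope_pos hw hM hM0 R
  rcases le_or_gt r 0 with hr | hr
  · rw [radialProfile_of_nonpos w R hr]; exact inv_pos.mpr hc
  · rw [radialProfile_of_pos w R hr]
    exact div_pos (radialSol_pos hw hM hM0 hr) (mul_pos hc hr)

/-- **`f ≤ 1`** (`u(r) ≤ r u'(r) ≤ r u'(R)` for `r ≤ R`; `f = 1 - a/r ≤ 1` beyond).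
[cite: LSSY2005, Thm. C.1 (A.2)] -/
theorem radialProfile_le_one (hw : Measurable w) (hM : ∀ r, w r ≤ ENNReal.ofReal M) (hM0 : 0 ≤ M)
    (hR : 0 < R) (hwR : ∀ s, R < s → w s = 0) (r : ℝ) : radialProfile w R r ≤ 1 := by
  have hc := slope_pos hw hM hM0 R
  rcases le_or_gt r 0 with hr | hr
  · rw [radialProfile_of_nonpos w R hr]
    exact inv_le_one_of_one_le₀ (one_le_radialSolDeriv hw hM hM0 R)
  rcases le_or_gt r R with hrR | hrR
  · rw [radialProfile_of_pos w R hr, div_le_one (mul_pos hc hr)]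
    calc radialSol w r ≤ r * radialSolDeriv w r := radialSol_le_mul_deriv hw hM hM0 hr.le
      _ ≤ r * radialSolDeriv w R := by gcongr; exact monotone_radialSolDeriv hw hM hM0 hrR
      _ = radialSolDeriv w R * r := mul_comm _ _
  · rw [radialProfile_eq_one_sub_div hw hM hM0 hR.le le_rfl hwR hrR]
    have := div_nonneg (odeScatteringLength_nonneg hw hM hM0 hR.le) hr.le
    linarith

/-- **`f` is differentiable on `(0, ∞)`**, `f'(r) = (r u'(r) - u(r))/(u'(R) r²)`.
[cite: LSSY2005, Thm. C.1] -/
theorem hasDerivAt_radialProfile (hw : Measurable w) (hM : ∀ r, w r ≤ ENNReal.ofReal M) (hM0 : 0 ≤ M)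
    (R : ℝ) {r : ℝ} (hr : 0 < r) :
    HasDerivAt (radialProfile w R)
      ((r * radialSolDeriv w r - radialSol w r) / (radialSolDeriv w R * r ^ 2)) r := by
  have hc := slope_pos hw hM hM0 R
  have hu := hasDerivAt_radialSol hw hM hM0 hr
  have hden : HasDerivAt (fun s => radialSolDeriv w R * s) (radialSolDeriv w R) r := by
    simpa using (hasDerivAt_id r).const_mul (radialSolDeriv w R)
  have hq := hu.div hden (mul_ne_zero hc.ne' hr.ne')
  have heq : radialProfile w R =ᶠ[𝓝 r] fun s => radialSol w s / (radialSolDeriv w R * s) := by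
    filter_upwards [Ioi_mem_nhds hr] with s hs
    exact radialProfile_of_pos w R hs
  refine (hq.congr_of_eventuallyEq heq).congr_deriv ?_
  field_simp

/-- The flux beyond the range: `r u'(r) - u(r) = R u'(R) - u(R)` (`= a u'(R)`) for `r ≥ R`.
[cite: LSSY2005, (2.5)] -/
theorem mul_deriv_sub_sol_of_ge (hw : Measurable w) (hM : ∀ r, w r ≤ ENNReal.ofReal M) (hM0 : 0 ≤ M)
    (hR : 0 ≤ R) (hwR : ∀ s, R < s → w s = 0) {r : ℝ} (hr : R ≤ r) :
    r * radialSolDeriv w r - radialSol w r = odeScatteringLength w R * radialSolDeriv w R := by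
  rw [radialSolDeriv_eq_of_ge hw hM hM0 hR hwR hr, radialSol_eq_of_ge hw hM hM0 hR hwR hr, odeScatteringLength]
  have hc := slope_pos hw hM hM0 R
  field_simp
  ring

/-- **Derivative bound**: `|f'(r)| ≤ L := (M/2) u(R)/u'(R) + a/R²` on `(0, ∞)`.
[cite: LSSY2005, Thm. C.1] -/
theorem abs_deriv_radialProfile_le (hw : Measurable w) (hM : ∀ r, w r ≤ ENNReal.ofReal M) (hM0 : 0 ≤ M)
    (hR : 0 < R) (hwR : ∀ s, R < s → w s = 0) {r : ℝ} (hr : 0 < r) :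
    |(r * radialSolDeriv w r - radialSol w r) / (radialSolDeriv w R * r ^ 2)| ≤
      M / 2 * radialSol w R / radialSolDeriv w R + odeScatteringLength w R / R ^ 2 := by
  have hc := slope_pos hw hM hM0 R
  have ha := odeScatteringLength_nonneg hw hM hM0 hR.le
  have hb := mul_deriv_sub_sol_bounds hw hM hM0 hr.le
  rw [abs_of_nonneg (div_nonneg hb.1 (by positivity))]
  have hA : 0 ≤ M / 2 * radialSol w R / radialSolDeriv w R :=
    div_nonneg (by have := radialSol_nonneg w R; positivity) hc.le
  have hB : 0 ≤ odeScatteringLength w R / R ^ 2 := by positivity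
  rcases le_or_gt r R with hrR | hrR
  · calc (r * radialSolDeriv w r - radialSol w r) / (radialSolDeriv w R * r ^ 2)
        ≤ M / 2 * r ^ 2 * radialSol w R / (radialSolDeriv w R * r ^ 2) := by
          gcongr
          exact hb.2.trans (by gcongr; exact radialSol_mono hw hM hM0 hr.le hrR)
      _ = M / 2 * radialSol w R / radialSolDeriv w R := by field_simp
      _ ≤ _ := le_add_of_nonneg_right hB
  · rw [mul_deriv_sub_sol_of_ge hw hM hM0 hR.le hwR hrR.le]
    calc odeScatteringLength w R * radialSolDeriv w R / (radialSolDeriv w R * r ^ 2)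
        = odeScatteringLength w R / r ^ 2 := by field_simp
      _ ≤ odeScatteringLength w R / R ^ 2 := by gcongr
      _ ≤ _ := le_add_of_nonneg_left hA

/-- The Volterra integrand `(r-s)(W/2)u` is integrable on `(0, r]`. [cite: LSSY2005, (2.4)] -/
theorem integrableOn_volterraIntegrand (hw : Measurable w) (hM : ∀ r, w r ≤ ENNReal.ofReal M) (hM0 : 0 ≤ M)
    {r : ℝ} (hr : 0 ≤ r) :
    IntegrableOn (fun s => (r - s) * ((w s).toReal / 2) * radialSol w s) (Ioc 0 r) := by
  refine integrableOn_Ioc_of_bound (C := r * (M / 2 * (r * Real.exp (M * r ^ 2 / 4))))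
    (((measurable_const.sub measurable_id).mul (hw.ennreal_toReal.div_const 2)).mul
      (measurable_radialSol hw)) fun s hs => ?_
  have h0 : 0 ≤ r - s := by linarith [hs.2]
  rw [mul_assoc, abs_of_nonneg (mul_nonneg h0 (derivIntegrand_nonneg w s))]
  exact mul_le_mul (by linarith [hs.1]) (derivIntegrand_le hw hM hM0 hs.2 hr) (derivIntegrand_nonneg w s) hr

/-- **Behaviour at the origin**: `0 ≤ f(r) - 1/u'(R) ≤ ((M/2) u(R)/u'(R)) r` for `0 < r ≤ R`.
[cite: LSSY2005, Thm. C.1] -/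
theorem radialProfile_sub_inv_bounds (hw : Measurable w) (hM : ∀ r, w r ≤ ENNReal.ofReal M) (hM0 : 0 ≤ M)
    {r : ℝ} (hr : 0 < r) (hrR : r ≤ R) :
    0 ≤ radialProfile w R r - (radialSolDeriv w R)⁻¹ ∧
      radialProfile w R r - (radialSolDeriv w R)⁻¹ ≤ M / 2 * radialSol w R / radialSolDeriv w R * r := by
  have hc := slope_pos hw hM hM0 R
  have hkey : radialProfile w R r - (radialSolDeriv w R)⁻¹ = (radialSol w r - r) / (radialSolDeriv w R * r) := by
    rw [radialProfile_of_pos w R hr]; field_simp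
  rw [hkey]
  have hI0 : 0 ≤ radialSol w r - r := by linarith [le_radialSol hw hM hM0 r]
  have hI : radialSol w r - r ≤ r * (M / 2 * radialSol w R) * r := by
    have hex : radialSol w r - r = ∫ s in Ioc 0 r, (r - s) * ((w s).toReal / 2) * radialSol w s := by
      rw [radialSol_eq hw hM hM0 hr.le]; ring
    rw [hex]
    calc ∫ s in Ioc 0 r, (r - s) * ((w s).toReal / 2) * radialSol w s
        ≤ ∫ _ in Ioc 0 r, r * (M / 2 * radialSol w R) := by
          refine setIntegral_mono_on (integrableOn_volterraIntegrand hw hM hM0 hr.le)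
            (integrableOn_const (by rw [Real.volume_Ioc]; exact ENNReal.ofReal_ne_top)) measurableSet_Ioc
            fun s hs => ?_
          have h1 : (w s).toReal / 2 ≤ M / 2 := by linarith [toReal_pot_le hM hM0 s]
          have h2 : radialSol w s ≤ radialSol w R := radialSol_mono hw hM hM0 hs.1.le (hs.2.trans hrR)
          have : 0 ≤ (w s).toReal / 2 := div_nonneg ENNReal.toReal_nonneg zero_le_two
          have := radialSol_nonneg w s
          have : 0 ≤ r - s := by linarith [hs.2]
          calc (r - s) * ((w s).toReal / 2) * radialSol w s ≤ r * (M / 2) * radialSol w R := by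
                gcongr; linarith [hs.1]
            _ = r * (M / 2 * radialSol w R) := by ring
      _ = r * (M / 2 * radialSol w R) * r := by
          rw [setIntegral_const, Real.volume_real_Ioc_of_le hr.le, sub_zero, smul_eq_mul]; ring
  constructor
  · exact div_nonneg hI0 (by positivity)
  · rw [div_le_iff₀ (by positivity)]
    calc radialSol w r - r ≤ r * (M / 2 * radialSol w R) * r := hI
      _ = M / 2 * radialSol w R / radialSolDeriv w R * r * (radialSolDeriv w R * r) := by
          field_simp

/-- **`f` is Lipschitz** on `ℝ` with constant `L = (M/2) u(R)/u'(R) + a/R²` (derivative bound on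
`(0, ∞)`, the bound at the origin, constancy on `(-∞, 0]`). [cite: LSSY2005, Thm. C.1] -/
theorem lipschitzWith_radialProfile (hw : Measurable w) (hM : ∀ r, w r ≤ ENNReal.ofReal M) (hM0 : 0 ≤ M)
    (hR : 0 < R) (hwR : ∀ s, R < s → w s = 0) :
    LipschitzWith (Real.toNNReal (M / 2 * radialSol w R / radialSolDeriv w R + odeScatteringLength w R / R ^ 2))
      (radialProfile w R) := by
  set L : ℝ := M / 2 * radialSol w R / radialSolDeriv w R + odeScatteringLength w R / R ^ 2 with hL
  have hc := slope_pos hw hM hM0 R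
  have hL1 : 0 ≤ M / 2 * radialSol w R / radialSolDeriv w R :=
    div_nonneg (by have := radialSol_nonneg w R; positivity) hc.le
  have hL2 : 0 ≤ odeScatteringLength w R / R ^ 2 := by
    have := odeScatteringLength_nonneg hw hM hM0 hR.le; positivity
  have hL0 : 0 ≤ L := add_nonneg hL1 hL2
  -- Lipschitz on `(0, ∞)` from the derivative bound
  have hpos : LipschitzOnWith (Real.toNNReal L) (radialProfile w R) (Ioi 0) := by
    refine (convex_Ioi 0).lipschitzOnWith_of_nnnorm_hasDerivWithin_le
      (fun r hr => (hasDerivAt_radialProfile hw hM hM0 R hr).hasDerivWithinAt) fun r hr => ?_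
    rw [← NNReal.coe_le_coe, coe_nnnorm, Real.norm_eq_abs, Real.coe_toNNReal _ hL0]
    exact abs_deriv_radialProfile_le hw hM hM0 hR hwR hr
  -- the bound `|f(s) - f(0)| ≤ L s` for `s > 0`
  have horig : ∀ s, 0 < s → |radialProfile w R s - (radialSolDeriv w R)⁻¹| ≤ L * s := by
    intro s hs
    set t := min s R with ht
    have ht0 : 0 < t := lt_min hs hR
    have hts : t ≤ s := min_le_left _ _
    have htR : t ≤ R := min_le_right _ _
    have h1 : |radialProfile w R s - radialProfile w R t| ≤ L * (s - t) := by
      have h := hpos.dist_le_mul s hs t ht0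
      rw [Real.dist_eq, Real.dist_eq, abs_of_nonneg (sub_nonneg.mpr hts), Real.coe_toNNReal _ hL0] at h
      exact h
    have h2 := radialProfile_sub_inv_bounds hw hM hM0 ht0 htR
    have h3 : |radialProfile w R t - (radialSolDeriv w R)⁻¹| ≤ L * t := by
      rw [abs_of_nonneg h2.1]
      calc radialProfile w R t - (radialSolDeriv w R)⁻¹ ≤ M / 2 * radialSol w R / radialSolDeriv w R * t := h2.2
        _ ≤ L * t := by rw [hL]; nlinarith
    calc |radialProfile w R s - (radialSolDeriv w R)⁻¹|
        = |(radialProfile w R s - radialProfile w R t) + (radialProfile w R t - (radialSolDeriv w R)⁻¹)| := by ring_nf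
      _ ≤ |radialProfile w R s - radialProfile w R t| + |radialProfile w R t - (radialSolDeriv w R)⁻¹| :=
          abs_add_le _ _
      _ ≤ L * (s - t) + L * t := add_le_add h1 h3
      _ = L * s := by ring
  refine LipschitzWith.of_dist_le_mul fun x y => ?_
  rw [Real.dist_eq, Real.dist_eq, Real.coe_toNNReal _ hL0]
  -- four cases according to the signs of `x` and `y`
  rcases le_or_gt x 0 with hx | hx <;> rcases le_or_gt y 0 with hy | hy
  · rw [radialProfile_of_nonpos w R hx, radialProfile_of_nonpos w R hy, sub_self, abs_zero]
    positivity
  · rw [radialProfile_of_nonpos w R hx, abs_sub_comm]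
    calc |radialProfile w R y - (radialSolDeriv w R)⁻¹| ≤ L * y := horig y hy
      _ ≤ L * |x - y| := by
          gcongr
          rw [abs_sub_comm]
          exact (le_abs_self _).trans' (by linarith)
  · rw [radialProfile_of_nonpos w R hy]
    calc |radialProfile w R x - (radialSolDeriv w R)⁻¹| ≤ L * x := horig x hx
      _ ≤ L * |x - y| := by
          gcongr
          exact (le_abs_self _).trans' (by linarith)
  · have h := hpos.dist_le_mul x hx y hy
    rw [Real.dist_eq, Real.dist_eq, Real.coe_toNNReal _ hL0] at h
    exact h

/-- `f` is continuous. [cite: LSSY2005, Thm. C.1] -/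
theorem continuous_radialProfile (hw : Measurable w) (hM : ∀ r, w r ≤ ENNReal.ofReal M) (hM0 : 0 ≤ M)
    (hR : 0 < R) (hwR : ∀ s, R < s → w s = 0) : Continuous (radialProfile w R) :=
  (lipschitzWith_radialProfile hw hM hM0 hR hwR).continuous

/-- **`φ₀ = f ∘ |·|` is Lipschitz on `ℝ³`.** [cite: LSSY2005, Thm. C.1] -/
theorem lipschitzWith_scatteringProfile (hw : Measurable w) (hM : ∀ r, w r ≤ ENNReal.ofReal M) (hM0 : 0 ≤ M)
    (hR : 0 < R) (hwR : ∀ s, R < s → w s = 0) :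
    LipschitzWith (Real.toNNReal (M / 2 * radialSol w R / radialSolDeriv w R + odeScatteringLength w R / R ^ 2))
      (scatteringProfile w R) := by
  have h := (lipschitzWith_radialProfile hw hM hM0 hR hwR).comp
    (lipschitzWith_one_norm : LipschitzWith 1 fun x : Space => ‖x‖)
  rw [mul_one] at h
  exact h

/-- `φ₀` is continuous, hence measurable. [cite: LSSY2005, Thm. C.1] -/
theorem continuous_scatteringProfile (hw : Measurable w) (hM : ∀ r, w r ≤ ENNReal.ofReal M) (hM0 : 0 ≤ M)
    (hR : 0 < R) (hwR : ∀ s, R < s → w s = 0) : Continuous (scatteringProfile w R) :=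
  (lipschitzWith_scatteringProfile hw hM hM0 hR hwR).continuous

/-- `0 < φ₀ ≤ 1`. [cite: LSSY2005, Thm. C.1 (A.2)] -/
theorem scatteringProfile_mem (hw : Measurable w) (hM : ∀ r, w r ≤ ENNReal.ofReal M) (hM0 : 0 ≤ M)
    (hR : 0 < R) (hwR : ∀ s, R < s → w s = 0) (x : Space) :
    0 < scatteringProfile w R x ∧ scatteringProfile w R x ≤ 1 :=
  ⟨radialProfile_pos hw hM hM0 R _, radialProfile_le_one hw hM hM0 hR hwR _⟩

/-- **`φ₀(x) = 1 - a/|x|` beyond any vanishing radius** `ρ` of `w` (`w = 0` on `(ρ, ∞)`), for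
`|x| > ρ`. [cite: LSSY2005, Thm. C.1 (C.7); Fournais2020, App. A (A.2)] -/
theorem scatteringProfile_eq_one_sub_div (hw : Measurable w) (hM : ∀ r, w r ≤ ENNReal.ofReal M) (hM0 : 0 ≤ M)
    (hR : 0 < R) (hwR : ∀ s, R < s → w s = 0) {ρ : ℝ} (hwρ : ∀ s, ρ < s → w s = 0)
    {x : Space} (hx : ρ < ‖x‖) :
    scatteringProfile w R x = 1 - odeScatteringLength w R / ‖x‖ := by
  -- the effective vanishing radius `ρ' = max 0 (min ρ R) ∈ [0, R]`
  set ρ' := max 0 (min ρ R) with hρ'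
  have hρ'0 : 0 ≤ ρ' := le_max_left _ _
  have hρ'R : ρ' ≤ R := max_le hR.le (min_le_right _ _)
  have hwρ' : ∀ s, ρ' < s → w s = 0 := by
    intro s hs
    rcases le_or_gt s R with hsR | hsR
    · refine hwρ s ?_
      have h1 : min ρ R < s := (le_max_right _ _).trans_lt hs
      rcases min_lt_iff.mp h1 with h | h
      · exact h
      · exact absurd h (not_lt.mpr hsR)
    · exact hwR s hsR
  rw [scatteringProfile]
  rcases lt_or_ge ρ' ‖x‖ with h | h
  · exact radialProfile_eq_one_sub_div hw hM hM0 hρ'0 hρ'R hwρ' h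
  · -- then `|x| = 0 = ρ'`, `ρ < 0`: the potential vanishes on `(0, ∞)`, `u(r) = r`, `a = 0`, `f = 1`
    have hx0 : ‖x‖ = 0 := by
      have h1 : ‖x‖ ≤ ρ' := h
      rcases le_or_gt ρ' 0 with h2 | h2
      · exact le_antisymm (h1.trans h2) (norm_nonneg _)
      · -- `ρ' > 0` means `ρ' = min ρ R ≤ ρ < ‖x‖`, contradiction
        exfalso
        have hm : 0 < min ρ R := by
          rcases lt_max_iff.mp (show 0 < max 0 (min ρ R) from h2) with h | h
          · exact absurd h (lt_irrefl _)
          · exact h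
        have h3 : ρ' = min ρ R := max_eq_right hm.le
        have h4 : ρ' ≤ ρ := h3 ▸ min_le_left _ _
        linarith
    have hρneg : ρ < 0 := by linarith [hx0]
    have hw0 : ∀ s, 0 < s → w s = 0 := fun s hs => hwρ s (hρneg.trans hs)
    -- `a = 0`
    have ha : odeScatteringLength w R = 0 := by
      have h1 := radialProfile_eq_one_sub_div hw hM hM0 le_rfl hR.le hw0 hR
      have h2 : radialProfile w R R = 1 := by
        rw [radialProfile_of_pos w R hR, radialSol_eq_of_ge hw hM hM0 le_rfl hw0 hR.le, radialSol_of_nonpos w le_rfl,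
          radialSolDeriv_eq_of_ge hw hM hM0 le_rfl hw0 hR.le]
        have := slope_pos hw hM hM0 (0 : ℝ)
        rw [zero_add, sub_zero, div_self (mul_pos this hR).ne']
      rw [h2] at h1
      have h3 : odeScatteringLength w R / R = 0 := by linarith
      rcases div_eq_zero_iff.mp h3 with h4 | h4
      · exact h4
      · exact absurd h4 hR.ne'
    rw [hx0, ha, zero_div, sub_zero, radialProfile_of_nonpos w R le_rfl,
      radialSolDeriv_eq_of_ge hw hM hM0 le_rfl hw0 hR.le]
    rw [radialSolDeriv_eq hw hM hM0, Ioc_self, Measure.restrict_empty, integral_zero_measure, add_zero, inv_one]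

end Profile

/-! ### Monotonicity in the potential (Wronskian comparison) -/

section Comparison

variable {w₁ w₂ : ℝ → ℝ≥0∞} {M R : ℝ}

/-- `W₁ ≤ W₂` for the real potentials if `w₁ ≤ w₂` (both finite). [folklore] -/
theorem toReal_pot_mono (hM₂ : ∀ r, w₂ r ≤ ENNReal.ofReal M) (h12 : ∀ r, w₁ r ≤ w₂ r) (r : ℝ) :
    (w₁ r).toReal ≤ (w₂ r).toReal :=
  ENNReal.toReal_mono (ne_top_of_le_ne_top ENNReal.ofReal_ne_top (hM₂ r)) (h12 r)

/-- `u₁ ≤ u₂` if `w₁ ≤ w₂`. [cite: LSSY2005, (2.4)] -/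
theorem radialSol_mono_pot (hw₂ : Measurable w₂) (hM₂ : ∀ r, w₂ r ≤ ENNReal.ofReal M) (hM0 : 0 ≤ M)
    (h12 : ∀ r, w₁ r ≤ w₂ r) (r : ℝ) : radialSol w₁ r ≤ radialSol w₂ r :=
  ENNReal.toReal_mono (radialSolE_ne_top hw₂ hM₂ hM0 r) (radialSolE_mono h12 r)

/-- `u₁' ≤ u₂'` if `w₁ ≤ w₂`. [cite: LSSY2005, (2.4)–(2.5)] -/
theorem radialSolDeriv_mono_pot (hw₁ : Measurable w₁) (hw₂ : Measurable w₂)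
    (hM₁ : ∀ r, w₁ r ≤ ENNReal.ofReal M) (hM₂ : ∀ r, w₂ r ≤ ENNReal.ofReal M) (hM0 : 0 ≤ M)
    (h12 : ∀ r, w₁ r ≤ w₂ r) (r : ℝ) : radialSolDeriv w₁ r ≤ radialSolDeriv w₂ r := by
  rw [radialSolDeriv_eq hw₁ hM₁ hM0, radialSolDeriv_eq hw₂ hM₂ hM0]
  gcongr 1
  rcases le_or_gt 0 r with hr | hr
  · refine setIntegral_mono_on (integrableOn_derivIntegrand hw₁ hM₁ hM0 hr)
      (integrableOn_derivIntegrand hw₂ hM₂ hM0 hr) measurableSet_Ioc fun s _ => ?_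
    have := toReal_pot_mono hM₂ h12 s
    have := radialSol_mono_pot hw₂ hM₂ hM0 h12 s
    have : 0 ≤ (w₁ s).toReal := ENNReal.toReal_nonneg
    have := radialSol_nonneg w₂ s
    have := radialSol_nonneg w₁ s
    gcongr
  · rw [Ioc_eq_empty (not_lt.mpr hr.le), Measure.restrict_empty, integral_zero_measure, integral_zero_measure]

/-- **The Wronskian identity** (integral product rule twice):
`u₁'(r)u₂(r) - u₁(r)u₂'(r) = ∫_0^r ½(W₁ - W₂) u₁ u₂`, `r ≥ 0`. [cite: LSSY2005, App. C, Lemma C.2] -/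
theorem wronskian_eq (hw₁ : Measurable w₁) (hw₂ : Measurable w₂)
    (hM₁ : ∀ r, w₁ r ≤ ENNReal.ofReal M) (hM₂ : ∀ r, w₂ r ≤ ENNReal.ofReal M) (hM0 : 0 ≤ M) {r : ℝ} (hr : 0 ≤ r) :
    radialSolDeriv w₁ r * radialSol w₂ r - radialSol w₁ r * radialSolDeriv w₂ r =
      ∫ s in Ioc 0 r, ((w₁ s).toReal / 2 * radialSol w₁ s * radialSol w₂ s -
        radialSol w₁ s * ((w₂ s).toReal / 2 * radialSol w₂ s)) := by
  have hc₁ := continuous_radialSolDeriv hw₁ hM₁ hM0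
  have hc₂ := continuous_radialSolDeriv hw₂ hM₂ hM0
  have hG₁ := integrableOn_derivIntegrand hw₁ hM₁ hM0 hr
  have hG₂ := integrableOn_derivIntegrand hw₂ hM₂ hM0 hr
  have hu₁' : IntegrableOn (radialSolDeriv w₁) (Ioc 0 r) := hc₁.integrableOn_Icc.mono_set Ioc_subset_Icc_self
  have hu₂' : IntegrableOn (radialSolDeriv w₂) (Ioc 0 r) := hc₂.integrableOn_Icc.mono_set Ioc_subset_Icc_self
  -- bounded measurable products are integrable on `(0, r]`
  have hB₁ := fun s (hs : s ∈ Ioc 0 r) => radialSol_le_bound hw₁ hM₁ hM0 hs.2 hr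
  have hB₂ := fun s (hs : s ∈ Ioc 0 r) => radialSol_le_bound hw₂ hM₂ hM0 hs.2 hr
  have hGu : IntegrableOn (fun s => (w₁ s).toReal / 2 * radialSol w₁ s * radialSol w₂ s) (Ioc 0 r) := by
    refine integrableOn_Ioc_of_bound (C := M / 2 * (r * Real.exp (M * r ^ 2 / 4)) * (r * Real.exp (M * r ^ 2 / 4)))
      ((measurable_derivIntegrand hw₁).mul (measurable_radialSol hw₂)) fun s hs => ?_
    rw [abs_of_nonneg (mul_nonneg (derivIntegrand_nonneg w₁ s) (radialSol_nonneg w₂ s))]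
    exact mul_le_mul (derivIntegrand_le hw₁ hM₁ hM0 hs.2 hr) (hB₂ s hs) (radialSol_nonneg w₂ s) (by positivity)
  have huG : IntegrableOn (fun s => radialSol w₁ s * ((w₂ s).toReal / 2 * radialSol w₂ s)) (Ioc 0 r) := by
    refine integrableOn_Ioc_of_bound (C := (r * Real.exp (M * r ^ 2 / 4)) * (M / 2 * (r * Real.exp (M * r ^ 2 / 4))))
      ((measurable_radialSol hw₁).mul (measurable_derivIntegrand hw₂)) fun s hs => ?_
    rw [abs_of_nonneg (mul_nonneg (radialSol_nonneg w₁ s) (derivIntegrand_nonneg w₂ s))]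
    exact mul_le_mul (hB₁ s hs) (derivIntegrand_le hw₂ hM₂ hM0 hs.2 hr) (derivIntegrand_nonneg w₂ s) (by positivity)
  have hu'u' : IntegrableOn (fun s => radialSolDeriv w₁ s * radialSolDeriv w₂ s) (Ioc 0 r) :=
    (hc₁.mul hc₂).integrableOn_Icc.mono_set Ioc_subset_Icc_self
  -- (a) `u₁' u₂`
  have ha := primitive_mul_primitive (A₀ := 1) (B₀ := 0) hr hG₁ hu₂'
    (A := radialSolDeriv w₁) (B := radialSol w₂)
    (fun t _ => radialSolDeriv_eq hw₁ hM₁ hM0 t)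
    (fun t ht => by rw [zero_add]; exact radialSol_eq_integral_deriv hw₂ hM₂ hM0 ht.1) hGu hu'u'
  -- (b) `u₁ u₂'`
  have hb := primitive_mul_primitive (A₀ := 0) (B₀ := 1) hr hu₁' hG₂
    (A := radialSol w₁) (B := radialSolDeriv w₂)
    (fun t ht => by rw [zero_add]; exact radialSol_eq_integral_deriv hw₁ hM₁ hM0 ht.1)
    (fun t _ => radialSolDeriv_eq hw₂ hM₂ hM0 t)
    (by simpa only [mul_comm] using hu'u') huG
  rw [mul_zero, sub_zero] at ha
  rw [zero_mul, sub_zero] at hb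
  rw [ha, hb, integral_add hGu hu'u', integral_add hu'u' huG, integral_sub hGu huG]
  ring

/-- The Wronskian is non-positive for `w₁ ≤ w₂`. [cite: LSSY2005, App. C, Lemma C.2] -/
theorem wronskian_nonpos (hw₁ : Measurable w₁) (hw₂ : Measurable w₂)
    (hM₁ : ∀ r, w₁ r ≤ ENNReal.ofReal M) (hM₂ : ∀ r, w₂ r ≤ ENNReal.ofReal M) (hM0 : 0 ≤ M)
    (h12 : ∀ r, w₁ r ≤ w₂ r) {r : ℝ} (hr : 0 ≤ r) :
    radialSolDeriv w₁ r * radialSol w₂ r - radialSol w₁ r * radialSolDeriv w₂ r ≤ 0 := by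
  rw [wronskian_eq hw₁ hw₂ hM₁ hM₂ hM0 hr]
  refine setIntegral_nonpos measurableSet_Ioc fun s _ => ?_
  have h1 := toReal_pot_mono hM₂ h12 s
  have h2 := radialSol_nonneg w₁ s
  have h3 := radialSol_nonneg w₂ s
  nlinarith [mul_nonneg h2 h3]

/-- **Comparison**: for `w₁ ≤ w₂` the ratio `u₂/u₁` is non-decreasing on `(0, ∞)`.
[cite: LSSY2005, App. C, Lemma C.2] -/
theorem monotoneOn_ratio (hw₁ : Measurable w₁) (hw₂ : Measurable w₂)
    (hM₁ : ∀ r, w₁ r ≤ ENNReal.ofReal M) (hM₂ : ∀ r, w₂ r ≤ ENNReal.ofReal M) (hM0 : 0 ≤ M)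
    (h12 : ∀ r, w₁ r ≤ w₂ r) :
    MonotoneOn (fun r => radialSol w₂ r / radialSol w₁ r) (Ioi 0) := by
  have hd : ∀ r, 0 < r → HasDerivAt (fun r => radialSol w₂ r / radialSol w₁ r)
      ((radialSolDeriv w₂ r * radialSol w₁ r - radialSol w₂ r * radialSolDeriv w₁ r) / radialSol w₁ r ^ 2) r :=
    fun r hr => (hasDerivAt_radialSol hw₂ hM₂ hM0 hr).div (hasDerivAt_radialSol hw₁ hM₁ hM0 hr)
      (radialSol_pos hw₁ hM₁ hM0 hr).ne'
  refine monotoneOn_of_deriv_nonneg (convex_Ioi 0) (fun r hr => (hd r hr).continuousAt.continuousWithinAt)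
    (fun r hr => ?_) fun r hr => ?_
  · rw [interior_Ioi] at hr
    exact (hd r hr).differentiableAt.differentiableWithinAt
  · rw [interior_Ioi] at hr
    rw [(hd r hr).deriv]
    refine div_nonneg ?_ (sq_nonneg _)
    have h := wronskian_nonpos hw₁ hw₂ hM₁ hM₂ hM0 h12 hr.le
    nlinarith

/-- The ratio `u₂/u₁` tends to `u₂'(R)/u₁'(R)` at infinity (both solutions are affine beyond `R`).
[cite: LSSY2005, (2.5)] -/
theorem tendsto_ratio (hw₁ : Measurable w₁) (hw₂ : Measurable w₂)
    (hM₁ : ∀ r, w₁ r ≤ ENNReal.ofReal M) (hM₂ : ∀ r, w₂ r ≤ ENNReal.ofReal M) (hM0 : 0 ≤ M)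
    (hR : 0 ≤ R) (hwR₁ : ∀ s, R < s → w₁ s = 0) (hwR₂ : ∀ s, R < s → w₂ s = 0) :
    Tendsto (fun r => radialSol w₂ r / radialSol w₁ r) atTop
      (𝓝 (radialSolDeriv w₂ R / radialSolDeriv w₁ R)) := by
  set c₁ := radialSolDeriv w₁ R
  set c₂ := radialSolDeriv w₂ R
  set b₁ := radialSol w₁ R - c₁ * R
  set b₂ := radialSol w₂ R - c₂ * R
  have hc₁ : 0 < c₁ := slope_pos hw₁ hM₁ hM0 R
  -- `u_i(r) = c_i r + b_i` for `r ≥ R`, so the ratio is `(c₂ + b₂/r)/(c₁ + b₁/r)` for large `r`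
  have hlim : Tendsto (fun r : ℝ => (c₂ + b₂ * r⁻¹) / (c₁ + b₁ * r⁻¹)) atTop (𝓝 (c₂ / c₁)) := by
    have h0 : Tendsto (fun r : ℝ => r⁻¹) atTop (𝓝 0) := tendsto_inv_atTop_zero
    have h2 : Tendsto (fun r : ℝ => c₂ + b₂ * r⁻¹) atTop (𝓝 c₂) := by
      simpa using tendsto_const_nhds.add (h0.const_mul b₂)
    have h1 : Tendsto (fun r : ℝ => c₁ + b₁ * r⁻¹) atTop (𝓝 c₁) := by
      simpa using tendsto_const_nhds.add (h0.const_mul b₁)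
    exact h2.div h1 hc₁.ne'
  refine hlim.congr' ?_
  filter_upwards [eventually_ge_atTop (max R 1)] with r hr
  have hrR : R ≤ r := (le_max_left _ _).trans hr
  have hr0 : 0 < r := one_pos.trans_le ((le_max_right _ _).trans hr)
  rw [radialSol_eq_of_ge hw₁ hM₁ hM0 hR hwR₁ hrR, radialSol_eq_of_ge hw₂ hM₂ hM0 hR hwR₂ hrR]
  have hden : c₁ + b₁ * r⁻¹ ≠ 0 := by
    have : c₁ + b₁ * r⁻¹ = (radialSol w₁ R + c₁ * (r - R)) / r := by
      field_simp; ring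
    rw [this]
    refine div_ne_zero (ne_of_gt ?_) hr0.ne'
    have h1 := radialSol_nonneg w₁ R
    have h2 : 0 ≤ c₁ * (r - R) := mul_nonneg hc₁.le (sub_nonneg.mpr hrR)
    -- `u₁(R) + c₁ (r - R) = u₁(r) > 0`
    rw [← radialSol_eq_of_ge hw₁ hM₁ hM0 hR hwR₁ hrR]
    exact radialSol_pos hw₁ hM₁ hM0 hr0
  field_simp
  ring

/-- **The profiles decrease as the potential increases**: `w₁ ≤ w₂` implies `f₂ ≤ f₁`
(`u₂/u₁ ↑ u₂'(R)/u₁'(R)` by the Wronskian). [cite: LSSY2005, App. C, Lemma C.2] -/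
theorem radialProfile_antitone_pot (hw₁ : Measurable w₁) (hw₂ : Measurable w₂)
    (hM₁ : ∀ r, w₁ r ≤ ENNReal.ofReal M) (hM₂ : ∀ r, w₂ r ≤ ENNReal.ofReal M) (hM0 : 0 ≤ M)
    (h12 : ∀ r, w₁ r ≤ w₂ r) (hR : 0 < R) (hwR₂ : ∀ s, R < s → w₂ s = 0) (r : ℝ) :
    radialProfile w₂ R r ≤ radialProfile w₁ R r := by
  have hwR₁ : ∀ s, R < s → w₁ s = 0 := fun s hs => le_zero_iff.mp ((h12 s).trans (hwR₂ s hs).le)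
  have hc₁ := slope_pos hw₁ hM₁ hM0 R
  have hc₂ := slope_pos hw₂ hM₂ hM0 R
  have hcc : radialSolDeriv w₁ R ≤ radialSolDeriv w₂ R := radialSolDeriv_mono_pot hw₁ hw₂ hM₁ hM₂ hM0 h12 R
  rcases le_or_gt r 0 with hr | hr
  · rw [radialProfile_of_nonpos w₂ R hr, radialProfile_of_nonpos w₁ R hr]
    exact inv_anti₀ hc₁ hcc
  have hu₁ := radialSol_pos hw₁ hM₁ hM0 hr
  have hq : radialSol w₂ r / radialSol w₁ r ≤ radialSolDeriv w₂ R / radialSolDeriv w₁ R := by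
    refine ge_of_tendsto (tendsto_ratio hw₁ hw₂ hM₁ hM₂ hM0 hR.le hwR₁ hwR₂) ?_
    filter_upwards [eventually_ge_atTop r] with s hs
    exact monotoneOn_ratio hw₁ hw₂ hM₁ hM₂ hM0 h12 (mem_Ioi.mpr hr) (mem_Ioi.mpr (hr.trans_le hs)) hs
  rw [radialProfile_of_pos w₂ R hr, radialProfile_of_pos w₁ R hr,
    div_le_div_iff₀ (mul_pos hc₂ hr) (mul_pos hc₁ hr)]
  rw [div_le_div_iff₀ hu₁ hc₁] at hq
  nlinarith [hq, hr]

/-- **The scattering profiles on `ℝ³` decrease as the potential increases.**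
[cite: LSSY2005, App. C, Lemma C.2] -/
theorem scatteringProfile_antitone_pot (hw₁ : Measurable w₁) (hw₂ : Measurable w₂)
    (hM₁ : ∀ r, w₁ r ≤ ENNReal.ofReal M) (hM₂ : ∀ r, w₂ r ≤ ENNReal.ofReal M) (hM0 : 0 ≤ M)
    (h12 : ∀ r, w₁ r ≤ w₂ r) (hR : 0 < R) (hwR₂ : ∀ s, R < s → w₂ s = 0) (x : Space) :
    scatteringProfile w₂ R x ≤ scatteringProfile w₁ R x :=
  radialProfile_antitone_pot hw₁ hw₂ hM₁ hM₂ hM0 h12 hR hwR₂ ‖x‖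

/-- **The scattering length increases with the potential** (`f_i(R) = 1 - a_i/R`).
[cite: LSSY2005, App. C, Lemma C.2] -/
theorem odeScatteringLength_mono_pot (hw₁ : Measurable w₁) (hw₂ : Measurable w₂)
    (hM₁ : ∀ r, w₁ r ≤ ENNReal.ofReal M) (hM₂ : ∀ r, w₂ r ≤ ENNReal.ofReal M) (hM0 : 0 ≤ M)
    (h12 : ∀ r, w₁ r ≤ w₂ r) (hR : 0 < R) (hwR₂ : ∀ s, R < s → w₂ s = 0) :
    odeScatteringLength w₁ R ≤ odeScatteringLength w₂ R := by
  have hwR₁ : ∀ s, R < s → w₁ s = 0 := fun s hs => le_zero_iff.mp ((h12 s).trans (hwR₂ s hs).le)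
  have h := radialProfile_antitone_pot hw₁ hw₂ hM₁ hM₂ hM0 h12 hR hwR₂ (R + 1)
  rw [radialProfile_eq_one_sub_div hw₁ hM₁ hM0 hR.le le_rfl hwR₁ (by linarith),
    radialProfile_eq_one_sub_div hw₂ hM₂ hM0 hR.le le_rfl hwR₂ (by linarith)] at h
  have hR1 : 0 < R + 1 := by linarith
  rw [sub_le_sub_iff_left, div_le_div_iff_of_pos_right hR1] at h
  exact h

end Comparison

/-! ### Integration by parts against the flux `r u'(r) - u(r)` (no second derivatives) -/

section Flux

variable {w : ℝ → ℝ≥0∞} {M : ℝ}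

/-- `s G(s)` is integrable on `(α, β]`, `0 ≤ α`. [cite: LSSY2005, (2.4)] -/
theorem integrableOn_mul_derivIntegrand (hw : Measurable w) (hM : ∀ r, w r ≤ ENNReal.ofReal M) (hM0 : 0 ≤ M)
    {α β : ℝ} (hα : 0 ≤ α) :
    IntegrableOn (fun s => s * ((w s).toReal / 2 * radialSol w s)) (Ioc α β) := by
  rcases le_or_gt β α with h | h
  · rw [Ioc_eq_empty (not_lt.mpr h)]; exact integrableOn_empty
  have hβ : 0 ≤ β := hα.trans h.le
  refine integrableOn_Ioc_of_bound (C := β * (M / 2 * (β * Real.exp (M * β ^ 2 / 4))))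
    (measurable_id.mul (measurable_derivIntegrand hw)) fun s hs => ?_
  have hs0 : 0 ≤ s := hα.trans hs.1.le
  rw [abs_of_nonneg (mul_nonneg hs0 (derivIntegrand_nonneg w s))]
  exact mul_le_mul hs.2 (derivIntegrand_le hw hM hM0 hs.2 hβ) (derivIntegrand_nonneg w s) hβ

/-- The flux as a primitive from `α`: `m(r) = m(α) + ∫_α^r s G(s) ds`, `m(r) = r u'(r) - u(r)`,
`0 ≤ α ≤ r`. [cite: LSSY2005, (2.4)–(2.5)] -/
theorem flux_eq_add_integral (hw : Measurable w) (hM : ∀ r, w r ≤ ENNReal.ofReal M) (hM0 : 0 ≤ M)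
    {α r : ℝ} (hα : 0 ≤ α) (hαr : α ≤ r) :
    r * radialSolDeriv w r - radialSol w r =
      (α * radialSolDeriv w α - radialSol w α) + ∫ s in Ioc α r, s * ((w s).toReal / 2 * radialSol w s) := by
  rw [mul_deriv_sub_sol_eq hw hM hM0 (hα.trans hαr), mul_deriv_sub_sol_eq hw hM hM0 hα,
    ← setIntegral_union (Ioc_disjoint_Ioc_of_le le_rfl) measurableSet_Ioc
      (integrableOn_mul_derivIntegrand hw hM hM0 le_rfl) (integrableOn_mul_derivIntegrand hw hM hM0 hα),
    Ioc_union_Ioc_eq_Ioc hα hαr]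

/-- The flux `m(r) = r u'(r) - u(r)` is bounded on `[0, β]`: `0 ≤ m ≤ (M/2) β³ e^{Mβ²/4}`.
[cite: LSSY2005, (2.4)–(2.5)] -/
theorem flux_le (hw : Measurable w) (hM : ∀ r, w r ≤ ENNReal.ofReal M) (hM0 : 0 ≤ M)
    {β r : ℝ} (hr : 0 ≤ r) (hrβ : r ≤ β) :
    r * radialSolDeriv w r - radialSol w r ≤ M / 2 * β ^ 2 * (β * Real.exp (M * β ^ 2 / 4)) := by
  have hβ := hr.trans hrβ
  calc r * radialSolDeriv w r - radialSol w r ≤ M / 2 * r ^ 2 * radialSol w r := (mul_deriv_sub_sol_bounds hw hM hM0 hr).2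
    _ ≤ M / 2 * β ^ 2 * (β * Real.exp (M * β ^ 2 / 4)) := by
        have := radialSol_le_bound hw hM hM0 hrβ hβ
        have := radialSol_nonneg w r
        gcongr

/-- **Integration by parts against the flux** (via Fubini, for `k ∈ C¹[α, β]`, `0 ≤ α ≤ β`):
`∫_α^β (r u' - u) k' dr = [(r u' - u) k]_α^β - ∫_α^β s G(s) k(s) ds` — the integrated form of
`(r²f')' = ½ r² W f` (times `u'(R)`), i.e. of the radial equation `u'' = ½ W u`.
[cite: LSSY2005, (2.4)–(2.5) and App. C (C.2)] -/
theorem flux_integral_mul_deriv (hw : Measurable w) (hM : ∀ r, w r ≤ ENNReal.ofReal M) (hM0 : 0 ≤ M)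
    {α β : ℝ} (hα : 0 ≤ α) (hαβ : α ≤ β) {k k' : ℝ → ℝ}
    (hk : ∀ r ∈ Icc α β, HasDerivAt k (k' r) r) (hk' : ContinuousOn k' (Icc α β)) :
    ∫ r in Ioc α β, (r * radialSolDeriv w r - radialSol w r) * k' r =
      (β * radialSolDeriv w β - radialSol w β) * k β - (α * radialSolDeriv w α - radialSol w α) * k α -
        ∫ s in Ioc α β, s * ((w s).toReal / 2 * radialSol w s) * k s := by
  set m : ℝ → ℝ := fun r => r * radialSolDeriv w r - radialSol w r with hm
  set g : ℝ → ℝ := fun s => s * ((w s).toReal / 2 * radialSol w s) with hg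
  have hkc : ContinuousOn k (Icc α β) := fun r hr => (hk r hr).continuousAt.continuousWithinAt
  have hgI : IntegrableOn g (Ioc α β) := integrableOn_mul_derivIntegrand hw hM hM0 hα
  have hk'I : IntegrableOn k' (Ioc α β) := (hk'.integrableOn_Icc).mono_set Ioc_subset_Icc_self
  have hgkI : IntegrableOn (fun s => g s * k s) (Ioc α β) :=
    hgI.mul_continuousOn_of_subset hkc measurableSet_Ioc isCompact_Icc Ioc_subset_Icc_self
  -- `m k'` is integrable: `m` bounded measurable, `k'` integrable
  have hmk'I : IntegrableOn (fun r => m r * k' r) (Ioc α β) := by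
    refine Integrable.bdd_mul (c := M / 2 * β ^ 2 * (β * Real.exp (M * β ^ 2 / 4))) hk'I
      ((measurable_id.mul (continuous_radialSolDeriv hw hM hM0).measurable).sub
        (measurable_radialSol hw)).aestronglyMeasurable ?_
    filter_upwards [ae_restrict_mem measurableSet_Ioc] with r hr
    have hr0 : 0 ≤ r := hα.trans hr.1.le
    rw [Real.norm_eq_abs, abs_of_nonneg (mul_deriv_sub_sol_bounds hw hM hM0 hr0).1]
    exact flux_le hw hM hM0 hr0 hr.2
  -- FTC on `[s, β]`
  have hftc : ∀ s ∈ Ioc α β, ∫ r in Ioc s β, k' r = k β - k s := by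
    intro s hs
    have hsub : Icc s β ⊆ Icc α β := Icc_subset_Icc hs.1.le le_rfl
    rw [← intervalIntegral.integral_of_le hs.2]
    exact intervalIntegral.integral_eq_sub_of_hasDerivAt (fun r hr => hk r (hsub (by rwa [uIcc_of_le hs.2] at hr)))
      ((hk'.mono hsub).intervalIntegrable_of_Icc hs.2)
  have hftcβ : ∫ r in Ioc α β, k' r = k β - k α := by
    rw [← intervalIntegral.integral_of_le hαβ]
    exact intervalIntegral.integral_eq_sub_of_hasDerivAt (fun r hr => hk r (by rwa [uIcc_of_le hαβ] at hr))
      (hk'.intervalIntegrable_of_Icc hαβ)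
  have hmβ : m β = m α + ∫ s in Ioc α β, g s := flux_eq_add_integral hw hM hM0 hα hαβ
  -- expand `m(r) = m(α) + ∫_α^r g` under the integral
  have heq : ∀ r ∈ Ioc α β, m r * k' r = m α * k' r + (∫ s in Ioc α r, g s) * k' r := fun r hr => by
    rw [show m r = m α + ∫ s in Ioc α r, g s from flux_eq_add_integral hw hM hM0 hα hr.1.le]; ring
  have hi2 : IntegrableOn (fun r => (∫ s in Ioc α r, g s) * k' r) (Ioc α β) := by
    have : (fun r => (∫ s in Ioc α r, g s) * k' r) =ᵐ[volume.restrict (Ioc α β)]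
        fun r => m r * k' r - m α * k' r := by
      filter_upwards [ae_restrict_mem measurableSet_Ioc] with r hr
      rw [heq r hr]; ring
    exact (hmk'I.sub (hk'I.const_mul _)).congr this.symm
  calc ∫ r in Ioc α β, m r * k' r
      = ∫ r in Ioc α β, (m α * k' r + (∫ s in Ioc α r, g s) * k' r) := setIntegral_congr_fun measurableSet_Ioc heq
    _ = m α * (k β - k α) + ∫ r in Ioc α β, (∫ s in Ioc α r, g s) * k' r := by
        rw [integral_add (hk'I.const_mul _) hi2, integral_const_mul, hftcβ]
    _ = m α * (k β - k α) + ∫ s in Ioc α β, g s * ∫ r in Ioc s β, k' r := by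
        rw [setIntegral_Ioc_primitive_mul hgI hk'I]
    _ = m α * (k β - k α) + ∫ s in Ioc α β, (k β * g s - g s * k s) := by
        congr 1
        refine setIntegral_congr_fun measurableSet_Ioc fun s hs => ?_
        rw [hftc s hs]; ring
    _ = m α * (k β - k α) + (k β * (m β - m α) - ∫ s in Ioc α β, g s * k s) := by
        rw [integral_sub (hgI.const_mul _) hgkI, integral_const_mul, hmβ]; ring
    _ = m β * k β - m α * k α - ∫ s in Ioc α β, g s * k s := by ring

end Flux

end Literature.MathematicalPhysics.QuantumManyBody.BoseGas

end
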